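import Summits.ValiantsHypothesis.ValiantsHypothesis.Theorems.FifoMatchingNNDivisionHardLocatedFaceExposure

/-!
# Sketch (val-idea-44 g0, W5-R2): TANGENT-CONE PRICING of zonotopal passengers and the locality wall of `CovZonoHard`

Typed companions of crux idea card `cone-pricing-zonotope-budget` (crux `FifoMatching.NNDivisionHard`, stmt-21181).
Statements (`def … : Prop`) + PROOFS (§5–§6, kernel-closed, no sorry): `rootedCliqueConeHard_holds`, `sandwich_three_pow_le`
(any `P` with `{(1,𝟙_b)(1,𝟙_b)ᵀ} ⊆ P ⊆ cone{bbᵀ}` has `3^n ≤ (xc+1)·2^n`), `zFull_own_three_pow_le`, `zFullUnbudgeted_holds`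
(`Z_full` is NOT a budgeted passenger — unconditional), §7 `shatteringTowerUnbudgeted_holds` (no positive tower whose index family
shatters a `(d+1)`-block has an EF of size `r` with `(r+2)·2^d < 3^d` — the VC form N13-VC), §8 `dot_coronaKernel`
(`⟨W, g_{A,B}⟩ = q_W(A∪B) − q_W(B)`), `qf_union_le` (singleton antitonicity telescopes) and `antitone_dot_corona_nonpos` (every antitone
`W` is nonpositive on the corona cone: the apex chamber of `Z_cor` contains the antitone cone — easy half of (C3)), §9 (P-R2b)
`RootedSandwichWitness` / `FanExpensiveBeyond` / `FanCheapUpTo` + `three_pow_le_of_witness`, `not_hasEF_of_fanExpensive` (THE SCHEMA as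
one kernel sentence: fan-expensive ⇒ not budgeted), `fanCheap_of_hasEF` (N13: budgeted ⇒ fan-cheap), `zFull_witness`, §10 (P-R2a)
`antitoneCone_eq_system` / `antitoneCone_hasEF` / `antitoneConeCheap_holds` (the antitone cone IS the projection of an explicit slack-form
system with `2h² + h` sign-constrained variables) and `antitone_iff_generators_nonpos` (polar = the pairing identity, generator level),
§11 `mem_coronaCone_of_polar` (Farkas half, via the in-tree conic `Literature.Barriers.PneNP.farkas`) and `coronaConePolarAntitone_holds`:
(C3) IS A KERNEL THEOREM — the apex normal chamber of the corona-covering zonotope is exactly the (cheap) antitone cone; §12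
`coronaCone_eq_dualSystem` / `coronaCone_hasEF` / `zCorApexConeCheap_holds`: the corona cone ITSELF has an explicit EF of size `2h² + h`
(the LP dual of §10) — THE LOCALITY WALL `ZCorApexConeCheap` is a kernel theorem.  Typed-only after rev 8: `TangentConeEF`,
`ZonotopeApexCone` (the heuristic layer, unused by the proofs); §13 `cliqueConeHard_holds` closes the unrooted variant.
REV 9 (§14, (C4) THE BALANCED FACE): `zCorSMUnbudgeted_holds : ∀ n h r, 2n+3 ≤ h → HasEFOfSize (zCorSM h) r → 3^n ≤ (r+1)·2^n` —
41's SIZE-MATCHED canonical covering zonotope `Z_cor` ((E4.5): zones `g_{A,B}`, `|A| = |B| ≥ 1`, `A ∪ B ≠ [h]`) is NOT budgeted: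
`xc(Z_cor(h)) ≥ 1.5^{⌊(h−3)/2⌋} − 1`.  The functional `W_R = −2J_R + (𝟙_R𝟙_{Rᶜ}ᵀ + 𝟙_{Rᶜ}𝟙_Rᵀ) − (6|R|+1)I_{Rᶜ}` prices every zone `≤ 0`
and is tight exactly on `A ⊆ R, B ⊆ Rᶜ` (whose `R×R` blocks are the clique matrices `P_A`); BFPS-on-the-block `+ λ·W_R` runs UDISJ on
`Z_cor` itself.  Size-matching is what opens this face: on the unrestricted `Z'_cor` the apex cone is cheap (§12).  §14b
`balancedFace_three_pow_le`: the same bound for ANY corona zone family of disjoint size-matched pairs containing one saturated block pair.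
Nothing here is a summit statement.
21181 OPEN; `CovZonoHard` OPEN; VP ≠ VNP NOT proved.

* `tangentCone`, `TangentConeEF`      — an EF of size `r` of a polytope gives one of size `r+1` of its tangent cone at any point.
* `ZonotopeApexCone`                   — at the vertex selected by a direction negative on every zone, the tangent cone of a zonotope
                                          is the cone generated by its zones.
* `cliqueCone`, `rootedCliqueCone`, `RootedCliqueConeHard`, `CliqueConeHard` — `cone{bbᵀ}` carries the UDISJ slack pattern
                                          (BFPS12 Prop. 3 inequalities `⟨(−1,a)(−1,a)ᵀ, X⟩ ≥ 0`): `3^n ≤ (r+1)·2^n`.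
* `zFull`, `ZFullUnbudgeted`           — COROLLARY: `Z_full = Σ_b [0,1]·bbᵀ` is NOT budgeted: `3^(h-1) ≤ (r+2)·2^(h-1)`.
* `coronaKernel`, `coronaCone`, `antitoneCone`, `AntitoneConeCheap`, `CoronaConePolarAntitone`, `ZCorApexConeCheap`
                                        — the wall: the apex cones of the corona-covering zonotope `Z_cor` (val-idea-41 rev 1.7 (E4.5))
                                          are polar to the antitone cone, which has an EF of size `2h² + h` (§10, PROVED).
-/

set_option linter.dupNamespace false

noncomputable section
open Matrix Finset
open scoped Pointwise

namespace Summit.ValiantsHypothesis.ValiantsHypothesis.Cruxes.NNDivisionHard.ConePricing44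

open Literature.Barriers.PneNP (HasEFOfSize)
open Literature.Combinatorics.Optimization (corPolytopeGraph corVec)

variable {h : ℕ}

/-! ## 1. Tangent cones inherit extended formulations -/

/-- the tangent (= feasible-directions) cone of `P` at `v`: `{t·(p − v) : t ≥ 0, p ∈ P}` (a convex cone when `P` is convex and `v ∈ P`). -/
def tangentCone {ι : Type} (P : Set (ι → ℝ)) (v : ι → ℝ) : Set (ι → ℝ) :=
  {x | ∃ t : ℝ, 0 ≤ t ∧ ∃ p ∈ P, x = t • (p - v)}

/-- ★ TANGENT-CONE PRICING (statement; paper proof 6 lines: homogenise the slack system `E x + F y = g, y ≥ 0` of `P` by one extra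
nonnegative variable `t`: `E x + F y' − t·(g − E v) = 0, y' ≥ 0, t ≥ 0`; boundedness of the polytope makes the `t = 0` slice `{0}`):
`xc(T_v P) ≤ xc(P) + 1` for every polytope `P = conv S` and every `v ∈ P`. -/
def TangentConeEF : Prop :=
  ∀ (N : ℕ) (S : Finset (Fin N → ℝ)) (v : Fin N → ℝ) (r : ℕ), v ∈ convexHull ℝ (↑S : Set (Fin N → ℝ)) →
    HasEFOfSize (convexHull ℝ (↑S : Set (Fin N → ℝ))) r → HasEFOfSize (tangentCone (convexHull ℝ (↑S : Set (Fin N → ℝ))) v) (r + 1)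

/-- the zonotope `Σ_i [0,1]·gen i` (base point `0`) as a set. -/
def zonotope {M : ℕ} (gen : Fin M → (Fin h × Fin h → ℝ)) : Set (Fin h × Fin h → ℝ) :=
  {x | ∃ μ : Fin M → ℝ, (∀ i, 0 ≤ μ i ∧ μ i ≤ 1) ∧ x = ∑ i, μ i • gen i}

/-- the cone generated by the zones. -/
def zoneCone {M : ℕ} (gen : Fin M → (Fin h × Fin h → ℝ)) : Set (Fin h × Fin h → ℝ) :=
  {x | ∃ μ : Fin M → ℝ, (∀ i, 0 ≤ μ i) ∧ x = ∑ i, μ i • gen i}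

/-- ★ APEX CONE OF A ZONOTOPE (statement; paper proof 4 lines): if a direction `C` is negative on every zone, then `0` is the vertex of
`Σ_i [0,1]·gen i` maximising `⟨C,·⟩`, and the tangent cone there is exactly the cone generated by the zones. -/
def ZonotopeApexCone : Prop :=
  ∀ (h M : ℕ) (gen : Fin M → (Fin h × Fin h → ℝ)) (C : Fin h × Fin h → ℝ),
    (∀ i, ∑ p, C p * gen i p < 0) → tangentCone (zonotope gen) 0 = zoneCone gen

/-! ## 2. The clique cone `cone{bbᵀ}` is UDISJ-hard (BFPS12 Prop. 3 pattern, Kaibel–Weltge count) -/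

/-- `cone{bbᵀ : b ∈ {0,1}^h}` (the completely-positive-0/1 / clique cone; `b = 0` contributes nothing). -/
def cliqueCone (h : ℕ) : Set (Fin h × Fin h → ℝ) :=
  {x | ∃ μ : (Fin h → Bool) → ℝ, (∀ b, 0 ≤ μ b) ∧ x = ∑ b, μ b • corVec (⊤ : SimpleGraph (Fin h)) b}

/-- the ROOTED clique cone `cone{(1,b)(1,b)ᵀ : b ∈ {0,1}^n} ⊂ Sym_{n+1}` (root = index `0`). -/
def rootedCliqueCone (n : ℕ) : Set (Fin (n + 1) × Fin (n + 1) → ℝ) :=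
  {x | ∃ μ : (Fin n → Bool) → ℝ, (∀ b, 0 ≤ μ b) ∧
    x = ∑ b, μ b • corVec (⊤ : SimpleGraph (Fin (n + 1))) (Fin.cons true b)}

/-- the generators lie in the rooted cone. -/
theorem corVec_cons_mem_rootedCliqueCone (n : ℕ) (b : Fin n → Bool) :
    corVec (⊤ : SimpleGraph (Fin (n + 1))) (Fin.cons true b) ∈ rootedCliqueCone n := by
  classical
  refine ⟨fun b' => if b' = b then 1 else 0, fun b' => by simp only; split_ifs <;> norm_num, ?_⟩
  simp [ite_smul, Finset.sum_ite_eq']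

/-- ★ ROOTED CLIQUE CONE IS HARD (statement; proof = `HasEFOfSize.three_pow_le` with points `v_b = (1,b)(1,b)ᵀ`, homogeneous valid
inequalities `⟨−(−1,a)(−1,a)ᵀ, X⟩ ≤ 0` whose slack at `v_b` is `(|a ∩ b| − 1)²`: zero iff `|a∩b| = 1`, positive on disjoint pairs
[BFPS12 Prop. 3, arXiv:1204.0957 p.8; on record via idea-38's coda]). -/
def RootedCliqueConeHard : Prop :=
  ∀ (n r : ℕ), HasEFOfSize (rootedCliqueCone n) r → 3 ^ n ≤ (r + 1) * 2 ^ n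

/-- ★ CLIQUE CONE IS HARD (statement): the direction `W = e₀𝟙ᵀ + 𝟙e₀ᵀ − 2I` has `⟨W, bbᵀ⟩ = 2|b|(b₀ − 1) ≤ 0`, `= 0` iff `b₀ = 1`, so the
rooted cone is the FACE `cliqueCone (n+1) ∩ {⟨W,·⟩ = 0}` (`HasEFOfSize.inter_eq` keeps the size). -/
def CliqueConeHard : Prop :=
  ∀ (n r : ℕ), HasEFOfSize (cliqueCone (n + 1)) r → 3 ^ n ≤ (r + 1) * 2 ^ n

/-! ## 3. Corollary: `Z_full` is not budgeted (unconditionally) -/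

/-- `Z_full(h) = Σ_{b ∈ {0,1}^h} [0,1]·bbᵀ` (the zone `b = 0` is the zero vector and harmless). -/
def zFull (h : ℕ) : Set (Fin h × Fin h → ℝ) :=
  {x | ∃ μ : (Fin h → Bool) → ℝ, (∀ b, 0 ≤ μ b ∧ μ b ≤ 1) ∧ x = ∑ b, μ b • corVec (⊤ : SimpleGraph (Fin h)) b}

/-- `0 ∈ Z_full`. -/
theorem zero_mem_zFull (h : ℕ) : (0 : Fin h × Fin h → ℝ) ∈ zFull h :=
  ⟨fun _ => 0, fun _ => by norm_num, by simp⟩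

/-- ★ `Z_full` IS NOT BUDGETED (statement): `xc(Z_full(n+1)) = r ⇒ 3^n ≤ (r + 2)·2^n`, i.e. `xc ≥ 1.5^n − 2`.
Chain: apex cone at direction `−I` (`ZonotopeApexCone`) = `cliqueCone (n+1)`; `TangentConeEF` (+1); `CliqueConeHard`.
This answers CRITIC-wave4 §2 «existence of a BUDGETED [saturating tower] is the first question» for `Z_full` itself, unconditionally
(on record only: decided AS A PASSENGER — `zFull_three_pow_le`, class K — and conditionally expensive via knapsack counting). -/
def ZFullUnbudgeted : Prop :=
  ∀ (n r : ℕ), HasEFOfSize (zFull (n + 1)) r → 3 ^ n ≤ (r + 2) * 2 ^ n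

/-- more generally (statement): any tower `Σ_{b ∈ 𝓑} [0,1]·λ_b bbᵀ`, `λ > 0`, whose index family SHATTERS a set `R` (`{b ∩ R} = 2^R`)
is not budgeted below `1.5^{|R|−1} − 2` (project the apex cone onto the `R × R` block: it is `cliqueCone |R|`). -/
def ShatteringTowerUnbudgeted : Prop :=
  ∀ (h d r : ℕ) (𝓑 : Finset (Fin h → Bool)) (lam : (Fin h → Bool) → ℝ) (ρ : Fin (d + 1) ↪ Fin h),
    (∀ b ∈ 𝓑, 0 < lam b) →
    (∀ s : Fin (d + 1) → Bool, ∃ b ∈ 𝓑, ∀ i, b (ρ i) = s i) →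
    HasEFOfSize {x | ∃ μ : (Fin h → Bool) → ℝ, (∀ b, 0 ≤ μ b ∧ μ b ≤ 1) ∧ (∀ b ∉ 𝓑, μ b = 0) ∧
        x = ∑ b, (μ b * lam b) • corVec (⊤ : SimpleGraph (Fin h)) b} r →
      3 ^ d ≤ (r + 2) * 2 ^ d

/-! ## 4. The wall: corona-covering zonotopes are apex-cheap -/

/-- indicator vector of a finset as a Boolean string. -/
def ind (A : Finset (Fin h)) : Fin h → Bool := fun p => decide (p ∈ A)

/-- the corona kernel `g_{A,B} = P_{A∪B} − P_B` (val-idea-41 rev 1.7 (E4.1)/(E4.5)): `1` on `A×A ∪ A×B ∪ B×A`, `0` elsewhere. -/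
def coronaKernel (A B : Finset (Fin h)) : Fin h × Fin h → ℝ :=
  corVec (⊤ : SimpleGraph (Fin h)) (ind (A ∪ B)) - corVec (⊤ : SimpleGraph (Fin h)) (ind B)

/-- the (unconstrained) corona cone `cone{g_{A,B} : A ≠ ∅, A ∩ B = ∅}` — the apex cone (direction `−I`) of
`Z'_cor = Σ_{(A,B)} [0,1]·g_{A,B}`; the size-matched `Z_cor` of (E4.5) has the same cone after projection to any block of size `< h/2`. -/
def coronaCone (h : ℕ) : Set (Fin h × Fin h → ℝ) :=
  {x | ∃ μ : Finset (Fin h) × Finset (Fin h) → ℝ, (∀ AB, 0 ≤ μ AB) ∧ (∀ AB, (AB.1 = ∅ ∨ ¬ Disjoint AB.1 AB.2) → μ AB = 0) ∧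
    x = ∑ AB, μ AB • coronaKernel AB.1 AB.2}

/-- the ANTITONE cone: symmetric `W` whose pseudo-Boolean quadratic `S ↦ 𝟙_Sᵀ W 𝟙_S` is non-increasing, in its singleton form
`W_xx + 2·Σ_{t ∈ T} W_xt ≤ 0` for all `x ∉ T` (these imply `q_W(S ∪ T) ≤ q_W(T)` for all disjoint `S, T` by telescoping). -/
def antitoneCone (h : ℕ) : Set (Fin h × Fin h → ℝ) :=
  {W | (∀ p q, W (p, q) = W (q, p)) ∧ ∀ (x : Fin h) (T : Finset (Fin h)), x ∉ T → W (x, x) + 2 * ∑ t ∈ T, W (x, t) ≤ 0}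

/-- ★ THE ANTITONE CONE IS CHEAP (statement; the EF: `u_xt ≥ 0`, `u_xt ≥ W_xt`, `W_xx + 2·Σ_{t ≠ x} u_xt ≤ 0` — `2h(h−1) + h ≤ 2h²`
inequalities in slack form; rev 5: the dominating variables are indexed by ALL ordered pairs, `u_xx` harmless, so the size is `2h² + h`). -/
def AntitoneConeCheap : Prop := ∀ h : ℕ, HasEFOfSize (antitoneCone h) (2 * h * h + h)

/-- ★ POLARITY (statement; Farkas): the corona cone is the polar of the antitone cone inside `Sym_h` —
`⟨W, g_{A,B}⟩ = q_W(A ∪ B) − q_W(B)`, so `W` is nonpositive on every corona kernel iff `q_W` is antitone. Polar cones have extended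
formulations of the same size (transpose the slack matrix), hence `xc(coronaCone h) ≤ 2h² (+ symmetry equations)`. -/
def CoronaConePolarAntitone : Prop :=
  ∀ (h : ℕ) (x : Fin h × Fin h → ℝ), (∀ p q, x (p, q) = x (q, p)) →
    (x ∈ coronaCone h ↔ ∀ W ∈ antitoneCone h, ∑ p, W p * x p ≤ 0)

/-- ★ THE LOCALITY WALL (statement): the apex cone of the corona-covering zonotope is cheap — `xc(coronaCone h) ≤ 2h² + h` (rev 7 constant; `2h² − h` by dropping the diagonal duals) — so
tangent-cone pricing (which un-budgets `Z_full` and every shattering tower) certifies NOTHING on `Z_cor`; the same holds after every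
diagonal-threshold re-signing (lineality ⊕ a corona cone on the positive block) and on every located face (self-similar).  STATUS rev 7:
PROVED (§12, `zCorApexConeCheap_holds`) by the explicit DUAL system `x_pq = (d_pq + d_qp)/2 + [p = q]·ρ_p`, `0 ≤ d_pq ≤ 2ρ_p`, `ρ ≥ 0`
(membership ⇐ via the Farkas half `mem_coronaCone_of_polar`; ⇒ by pricing each generator `g_{A,B}` with `ρ = 𝟙_A`). -/
def ZCorApexConeCheap : Prop := ∀ h : ℕ, HasEFOfSize (coronaCone h) (2 * h * h + h)


/-! ## 5. PROOF of `RootedCliqueConeHard` (kernel food: the clique cone carries the UDISJ pattern) -/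

/-- indicator of a Boolean string as a real. -/
def chi {m : ℕ} (b : Fin m → Bool) (p : Fin m) : ℝ := if b p then 1 else 0

/-- on the complete graph, `corVec b` is the rank-one 0/1 matrix `𝟙_b 𝟙_bᵀ`. -/
theorem corVec_top_apply {m : ℕ} (b : Fin m → Bool) (p q : Fin m) :
    corVec (⊤ : SimpleGraph (Fin m)) b (p, q) = chi b p * chi b q := by
  unfold corVec chi
  by_cases hpq : p = q
  · subst hpq; cases b p <;> simp
  · simp only [hpq, SimpleGraph.top_adj, ne_eq, not_false_eq_true, if_true, if_false]
    cases b p <;> cases b q <;> simp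

/-- a rank-one functional `X ↦ Σ_{p,q} w_p w_q X_{pq}` evaluates on `𝟙_b𝟙_bᵀ` to the square `(w·𝟙_b)²`. -/
theorem rankOne_dot_corVec {m : ℕ} (w : Fin m → ℝ) (b : Fin m → Bool) :
    (fun x : Fin m × Fin m => w x.1 * w x.2) ⬝ᵥ corVec (⊤ : SimpleGraph (Fin m)) b
      = (∑ p, w p * chi b p) ^ 2 := by
  simp only [dotProduct, Fintype.sum_prod_type, corVec_top_apply]
  rw [sq, Finset.sum_mul_sum]
  exact Finset.sum_congr rfl fun p _ => Finset.sum_congr rfl fun q _ => by ring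

/-- the BFPS vector `u_a = (−1, 𝟙_a)`. -/
def uVec {n : ℕ} (a : Finset (Fin n)) : Fin (n + 1) → ℝ :=
  Fin.cons (-1) fun i => if i ∈ a then 1 else 0

/-- the inequality normals `c_a = −u_a u_aᵀ` (so `c_a · X ≤ 0` reads `⟨u_a u_aᵀ, X⟩ ≥ 0`). -/
def cIneq {n : ℕ} (a : Finset (Fin n)) : Fin (n + 1) × Fin (n + 1) → ℝ :=
  fun x => -(uVec a x.1 * uVec a x.2)

/-- the points `v_b = (1, 𝟙_b)(1, 𝟙_b)ᵀ`. -/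
def vPt {n : ℕ} (b : Finset (Fin n)) : Fin (n + 1) × Fin (n + 1) → ℝ :=
  corVec (⊤ : SimpleGraph (Fin (n + 1))) (Fin.cons true fun i => decide (i ∈ b))

theorem cIneq_dot_corVec {n : ℕ} (a : Finset (Fin n)) (b : Fin n → Bool) :
    cIneq a ⬝ᵥ corVec (⊤ : SimpleGraph (Fin (n + 1))) (Fin.cons true b)
      = -((∑ p, uVec a p * chi (Fin.cons true b : Fin (n + 1) → Bool) p) ^ 2) := by
  rw [show cIneq a = -(fun x : Fin (n + 1) × Fin (n + 1) => uVec a x.1 * uVec a x.2) from rfl,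
    neg_dotProduct, rankOne_dot_corVec]

theorem sum_uVec_chi {n : ℕ} (a b : Finset (Fin n)) :
    ∑ p, uVec a p * chi (Fin.cons true (fun i => decide (i ∈ b)) : Fin (n + 1) → Bool) p
      = ((a ∩ b).card : ℝ) - 1 := by
  rw [Fin.sum_univ_succ]
  have h0 : uVec a 0 * chi (Fin.cons true (fun i => decide (i ∈ b)) : Fin (n + 1) → Bool) 0 = -1 := by
    simp [uVec, chi]
  have hs : ∀ i : Fin n, uVec a i.succ * chi (Fin.cons true (fun i => decide (i ∈ b)) : Fin (n + 1) → Bool) i.succ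
      = if i ∈ a ∩ b then 1 else 0 := by
    intro i
    by_cases ha : i ∈ a <;> by_cases hb : i ∈ b <;> simp [uVec, chi, ha, hb]
  rw [h0, Finset.sum_congr rfl fun i _ => hs i, Finset.sum_boole]
  have hf : Finset.univ.filter (fun i => i ∈ a ∩ b) = a ∩ b := by ext i; simp
  rw [hf]
  ring

theorem cIneq_dot_vPt {n : ℕ} (a b : Finset (Fin n)) :
    cIneq a ⬝ᵥ vPt b = -((((a ∩ b).card : ℝ) - 1) ^ 2) := by
  rw [vPt, cIneq_dot_corVec, sum_uVec_chi]

/-- ★ PROVED: the rooted clique cone `cone{(1,b)(1,b)ᵀ}` has no extended formulation of size `r` with `(r+1)·2^n < 3^n`. -/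
theorem rootedCliqueConeHard_holds : RootedCliqueConeHard := by
  classical
  intro n r hEF
  refine hEF.three_pow_le vPt (fun b => corVec_cons_mem_rootedCliqueCone n _) cIneq (fun _ => 0) ?_ ?_ ?_
  · rintro a x ⟨μ, hμ, rfl⟩
    rw [dotProduct_sum]
    refine Finset.sum_nonpos fun b _ => ?_
    rw [dotProduct_smul, smul_eq_mul, cIneq_dot_corVec]
    exact mul_nonpos_of_nonneg_of_nonpos (hμ b) (neg_nonpos.mpr (sq_nonneg _))
  · intro a b hlt hcard
    rw [cIneq_dot_vPt, hcard] at hlt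
    norm_num at hlt
  · intro a b hab
    rw [cIneq_dot_vPt, Finset.disjoint_iff_inter_eq_empty.mp hab]
    norm_num


/-! ## 6. PROOF that `Z_full` is not budgeted — directly: `Z_full` is SANDWICHED between the rooted rank-one points and the clique
cone, and the BFPS inequalities are homogeneous, so the UDISJ pattern survives on `Z_full` itself (no tangent cone needed in the kernel). -/

theorem cIneq_dot_corVec' {n : ℕ} (a : Finset (Fin n)) (b : Fin (n + 1) → Bool) :
    cIneq a ⬝ᵥ corVec (⊤ : SimpleGraph (Fin (n + 1))) b = -((∑ p, uVec a p * chi b p) ^ 2) := by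
  rw [show cIneq a = -(fun x : Fin (n + 1) × Fin (n + 1) => uVec a x.1 * uVec a x.2) from rfl,
    neg_dotProduct, rankOne_dot_corVec]

/-- the BFPS functionals are nonpositive on the whole clique cone. -/
theorem cIneq_dot_nonpos_of_mem_cliqueCone {n : ℕ} (a : Finset (Fin n)) {x : Fin (n + 1) × Fin (n + 1) → ℝ}
    (hx : x ∈ cliqueCone (n + 1)) : cIneq a ⬝ᵥ x ≤ 0 := by
  classical
  obtain ⟨μ, hμ, rfl⟩ := hx
  rw [dotProduct_sum]
  refine Finset.sum_nonpos fun b _ => ?_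
  rw [dotProduct_smul, smul_eq_mul, cIneq_dot_corVec']
  exact mul_nonpos_of_nonneg_of_nonpos (hμ b) (neg_nonpos.mpr (sq_nonneg _))

/-- ★ CLIQUE-CONE SANDWICH (PROVED): any set containing the rooted rank-one points `(1,𝟙_b)(1,𝟙_b)ᵀ` and contained in the clique cone
`cone{bbᵀ}` has no EF of size `r` with `(r+1)·2^n < 3^n` — i.e. `xc ≥ 1.5^n − 1`. -/
theorem sandwich_three_pow_le {n r : ℕ} {P : Set (Fin (n + 1) × Fin (n + 1) → ℝ)}
    (hpts : ∀ b : Finset (Fin n), vPt b ∈ P) (hsub : P ⊆ cliqueCone (n + 1)) (hP : HasEFOfSize P r) :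
    3 ^ n ≤ (r + 1) * 2 ^ n := by
  classical
  refine hP.three_pow_le vPt hpts cIneq (fun _ => 0) ?_ ?_ ?_
  · intro a x hx
    exact cIneq_dot_nonpos_of_mem_cliqueCone a (hsub hx)
  · intro a b hlt hcard
    rw [cIneq_dot_vPt, hcard] at hlt
    norm_num at hlt
  · intro a b hab
    rw [cIneq_dot_vPt, Finset.disjoint_iff_inter_eq_empty.mp hab]
    norm_num

theorem vPt_mem_zFull {n : ℕ} (b : Finset (Fin n)) : vPt b ∈ zFull (n + 1) := by
  classical
  refine ⟨fun b' => if b' = (Fin.cons true fun i => decide (i ∈ b)) then 1 else 0,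
    fun b' => by simp only; split_ifs <;> norm_num, ?_⟩
  simp [vPt, ite_smul, Finset.sum_ite_eq']

theorem zFull_subset_cliqueCone (h : ℕ) : zFull h ⊆ cliqueCone h := by
  rintro x ⟨μ, hμ, rfl⟩
  exact ⟨μ, fun b => (hμ b).1, rfl⟩

/-- ★ PROVED, sharper than `ZFullUnbudgeted`: `xc(Z_full(n+1)) = r ⇒ 3^n ≤ (r+1)·2^n`. `Z_full` is NOT a budgeted passenger. -/
theorem zFull_own_three_pow_le (n r : ℕ) (hP : HasEFOfSize (zFull (n + 1)) r) : 3 ^ n ≤ (r + 1) * 2 ^ n :=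
  sandwich_three_pow_le vPt_mem_zFull (zFull_subset_cliqueCone (n + 1)) hP

/-- ★ `ZFullUnbudgeted` HOLDS. -/
theorem zFullUnbudgeted_holds : ZFullUnbudgeted := fun n r hP =>
  (zFull_own_three_pow_le n r hP).trans (Nat.mul_le_mul_right _ (Nat.le_succ _))


/-! ## 7. PROOF of `ShatteringTowerUnbudgeted` (C2): the same sandwich on a shattered block — points = (scaled) zones whose pattern on
the block is rooted, inequalities = BFPS functionals pushed forward along the block embedding. -/

theorem negRankOne_dot_corVec {m : ℕ} (w : Fin m → ℝ) (b : Fin m → Bool) :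
    (fun x : Fin m × Fin m => -(w x.1 * w x.2)) ⬝ᵥ corVec (⊤ : SimpleGraph (Fin m)) b = -((∑ p, w p * chi b p) ^ 2) := by
  rw [show (fun x : Fin m × Fin m => -(w x.1 * w x.2)) = -(fun x : Fin m × Fin m => w x.1 * w x.2) from rfl,
    neg_dotProduct, rankOne_dot_corVec]

/-- the BFPS vector `u_a` pushed forward along a block embedding `ρ` (zero off the block). -/
def uPush {h d : ℕ} (ρ : Fin (d + 1) ↪ Fin h) (a : Finset (Fin d)) : Fin h → ℝ :=
  fun p => ∑ i, if ρ i = p then uVec a i else 0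

theorem sum_uPush_chi {h d : ℕ} (ρ : Fin (d + 1) ↪ Fin h) (a : Finset (Fin d)) (b : Fin h → Bool) :
    ∑ p, uPush ρ a p * chi b p = ∑ i, uVec a i * chi b (ρ i) := by
  simp only [uPush, Finset.sum_mul]
  rw [Finset.sum_comm]
  refine Finset.sum_congr rfl fun i _ => ?_
  simp [ite_mul]

/-- ★ `ShatteringTowerUnbudgeted` HOLDS (in fact with `r + 1`). -/
theorem shatteringTowerUnbudgeted_holds : ShatteringTowerUnbudgeted := by
  classical
  intro h d r 𝓑 lam ρ hlam hsh hEF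
  choose bsel hbmem hbpat using fun a : Finset (Fin d) => hsh (Fin.cons true fun i => decide (i ∈ a))
  -- the slack computation at the selected zones
  have hslack : ∀ a a' : Finset (Fin d),
      (fun x : Fin h × Fin h => -(uPush ρ a x.1 * uPush ρ a x.2)) ⬝ᵥ
          (lam (bsel a') • corVec (⊤ : SimpleGraph (Fin h)) (bsel a'))
        = lam (bsel a') * -((((a ∩ a').card : ℝ) - 1) ^ 2) := by
    intro a a'
    rw [dotProduct_smul, smul_eq_mul, negRankOne_dot_corVec, sum_uPush_chi]
    have : ∑ i, uVec a i * chi (bsel a') (ρ i)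
        = ∑ i, uVec a i * chi (Fin.cons true (fun j => decide (j ∈ a')) : Fin (d + 1) → Bool) i :=
      Finset.sum_congr rfl fun i _ => by simp only [chi, hbpat a' i]
    rw [this, sum_uVec_chi]
  have key : 3 ^ d ≤ (r + 1) * 2 ^ d := by
    refine hEF.three_pow_le (fun a => lam (bsel a) • corVec (⊤ : SimpleGraph (Fin h)) (bsel a)) ?_
      (fun a x => -(uPush ρ a x.1 * uPush ρ a x.2)) (fun _ => 0) ?_ ?_ ?_
    · -- the selected (scaled) zones lie in the tower
      intro a
      refine ⟨fun b => if b = bsel a then 1 else 0, fun b => by simp only; split_ifs <;> norm_num,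
        fun b hb => ?_, ?_⟩
      · simp only
        rw [if_neg]
        rintro rfl
        exact hb (hbmem a)
      · simp [ite_mul, ite_smul, Finset.sum_ite_eq']
    · -- validity: the functionals are nonpositive on every point of the tower
      rintro a x ⟨μ, hμ, hμoff, rfl⟩
      rw [dotProduct_sum]
      refine Finset.sum_nonpos fun b _ => ?_
      rw [dotProduct_smul, smul_eq_mul, negRankOne_dot_corVec]
      have hcoef : 0 ≤ μ b * lam b := by
        by_cases hb : b ∈ 𝓑
        · exact mul_nonneg (hμ b).1 (hlam b hb).le
        · rw [hμoff b hb]; simp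
      exact mul_nonpos_of_nonneg_of_nonpos hcoef (neg_nonpos.mpr (sq_nonneg _))
    · intro a a' hlt hcard
      rw [hslack, hcard] at hlt
      norm_num at hlt
    · intro a a' hab
      rw [hslack, Finset.disjoint_iff_inter_eq_empty.mp hab]
      have := hlam _ (hbmem a')
      norm_num
      linarith
  exact key.trans (Nat.mul_le_mul_right _ (Nat.le_succ _))


/-! ## 8. (C3) in kernel, easy half: corona kernels pair with `W` to increments of `q_W`; singleton antitonicity telescopes;
hence every antitone `W` is nonpositive on the whole corona cone (the apex chamber of `Z_cor` CONTAINS the antitone cone). -/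

/-- the pseudo-Boolean quadratic `q_W(S) = Σ_{x,y ∈ S} W_{xy}`. -/
def qf (W : Fin h × Fin h → ℝ) (S : Finset (Fin h)) : ℝ := ∑ x ∈ S, ∑ y ∈ S, W (x, y)

theorem chi_ind (S : Finset (Fin h)) (x : Fin h) : chi (ind S) x = if x ∈ S then 1 else 0 := by
  simp [chi, ind]

/-- `⟨W, 𝟙_S𝟙_Sᵀ⟩ = q_W(S)`. -/
theorem dot_corVec_ind (W : Fin h × Fin h → ℝ) (S : Finset (Fin h)) :
    W ⬝ᵥ corVec (⊤ : SimpleGraph (Fin h)) (ind S) = qf W S := by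
  classical
  simp only [dotProduct, Fintype.sum_prod_type, corVec_top_apply, chi_ind, qf]
  have inner : ∀ x, ∑ y, W (x, y) * ((if x ∈ S then (1:ℝ) else 0) * (if y ∈ S then 1 else 0))
      = if x ∈ S then ∑ y ∈ S, W (x, y) else 0 := by
    intro x
    by_cases hx : x ∈ S
    · have : ∀ y, W (x, y) * ((if x ∈ S then (1:ℝ) else 0) * (if y ∈ S then 1 else 0)) = if y ∈ S then W (x, y) else 0 := by
        intro y; by_cases hy : y ∈ S <;> simp [hx, hy]
      rw [Finset.sum_congr rfl fun y _ => this y, Finset.sum_ite_mem, Finset.univ_inter, if_pos hx]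
    · have : ∀ y, W (x, y) * ((if x ∈ S then (1:ℝ) else 0) * (if y ∈ S then 1 else 0)) = 0 := by
        intro y; simp [hx]
      rw [Finset.sum_congr rfl fun y _ => this y, Finset.sum_const_zero, if_neg hx]
  rw [Finset.sum_congr rfl fun x _ => inner x, Finset.sum_ite_mem, Finset.univ_inter]

/-- `⟨W, g_{A,B}⟩ = q_W(A ∪ B) − q_W(B)`. -/
theorem dot_coronaKernel (W : Fin h × Fin h → ℝ) (A B : Finset (Fin h)) :
    W ⬝ᵥ coronaKernel A B = qf W (A ∪ B) - qf W B := by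
  rw [coronaKernel, dotProduct_sub, dot_corVec_ind, dot_corVec_ind]

/-- one antitone step: for symmetric `W`, `q_W(T + x) = q_W(T) + W_xx + 2·Σ_{t∈T} W_xt`. -/
theorem qf_insert (W : Fin h × Fin h → ℝ) (hW : ∀ p q, W (p, q) = W (q, p)) {x : Fin h} {T : Finset (Fin h)}
    (hx : x ∉ T) : qf W (insert x T) = qf W T + (W (x, x) + 2 * ∑ t ∈ T, W (x, t)) := by
  classical
  unfold qf
  rw [Finset.sum_insert hx, Finset.sum_insert hx]
  have : ∑ a ∈ T, ∑ b ∈ insert x T, W (a, b) = ∑ a ∈ T, (W (a, x) + ∑ b ∈ T, W (a, b)) :=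
    Finset.sum_congr rfl fun a _ => Finset.sum_insert hx
  rw [this, Finset.sum_add_distrib]
  have hsym : ∑ a ∈ T, W (a, x) = ∑ t ∈ T, W (x, t) := Finset.sum_congr rfl fun t _ => hW t x
  rw [hsym]
  ring

/-- singleton antitonicity telescopes: `q_W(S ∪ T) ≤ q_W(T)` for disjoint `S, T`. -/
theorem qf_union_le (W : Fin h × Fin h → ℝ) (hW : W ∈ antitoneCone h) (S T : Finset (Fin h))
    (hST : Disjoint S T) : qf W (S ∪ T) ≤ qf W T := by
  classical
  induction S using Finset.induction_on with
  | empty => simp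
  | @insert x S' hxS ih =>
    have hxT : x ∉ T := Finset.disjoint_left.mp hST (Finset.mem_insert_self x S')
    have hS'T : Disjoint S' T := Disjoint.mono_left (Finset.subset_insert x S') hST
    have hx : x ∉ S' ∪ T := by simp [hxS, hxT]
    rw [Finset.insert_union, qf_insert W hW.1 hx]
    have hstep := hW.2 x (S' ∪ T) hx
    linarith [ih hS'T]

/-- ★ PROVED (easy half of `CoronaConePolarAntitone`): every antitone `W` is nonpositive on the corona cone —
the normal cone of `Z'_cor` at its apex contains the (cheap) antitone cone. -/
theorem antitone_dot_corona_nonpos {W x : Fin h × Fin h → ℝ} (hW : W ∈ antitoneCone h) (hx : x ∈ coronaCone h) :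
    W ⬝ᵥ x ≤ 0 := by
  classical
  obtain ⟨μ, hμ, hμ0, rfl⟩ := hx
  rw [dotProduct_sum]
  refine Finset.sum_nonpos fun AB _ => ?_
  rw [dotProduct_smul, smul_eq_mul, dot_coronaKernel]
  by_cases hd : Disjoint AB.1 AB.2
  · exact mul_nonpos_of_nonneg_of_nonpos (hμ AB) (sub_nonpos.mpr (qf_union_le W hW _ _ hd))
  · rw [hμ0 AB (Or.inr hd)]; simp


/-! ## 9. P-R2b — THE SCHEMA AS ONE KERNEL SENTENCE: located rooted-sandwich witnesses (fan-expensiveness) forbid a budget;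
N13 (fan-cheapness) is the typed necessary condition on any budgeted residual. -/

/-- a LOCATED ROOTED-SANDWICH WITNESS of dimension `n` for `Z ⊆ ℝ^ι`: a located flat (finitely many hyperplane equations — faces and
faces of faces are of this form) and a linear map (block projection, re-signing, quotient) under which that section of `Z` lands between
the rooted rank-one points `(1,𝟙_b)(1,𝟙_b)ᵀ` and the clique cone `cone{bbᵀ}` of `Sym_{n+1}`. -/
def RootedSandwichWitness {ι : Type} [Fintype ι] (Z : Set (ι → ℝ)) (n : ℕ) : Prop :=
  ∃ (k : ℕ) (cv : Fin k → ι → ℝ) (δ : Fin k → ℝ) (L : (ι → ℝ) →ₗ[ℝ] (Fin (n + 1) × Fin (n + 1) → ℝ)),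
    (∀ b : Finset (Fin n), vPt b ∈ L '' (Z ∩ {x | ∀ t, cv t ⬝ᵥ x = δ t})) ∧
    L '' (Z ∩ {x | ∀ t, cv t ⬝ᵥ x = δ t}) ⊆ cliqueCone (n + 1)

/-- `Z` is FAN-EXPENSIVE beyond `R`: some located rooted-sandwich witness has a dimension `n` with `(R+1)·2^n < 3^n`. -/
def FanExpensiveBeyond {ι : Type} [Fintype ι] (Z : Set (ι → ℝ)) (R : ℕ) : Prop :=
  ∃ n, (R + 1) * 2 ^ n < 3 ^ n ∧ RootedSandwichWitness Z n

/-- N13: `Z` is FAN-CHEAP up to `R` — no located rooted-sandwich witness beats `R`. -/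
def FanCheapUpTo {ι : Type} [Fintype ι] (Z : Set (ι → ℝ)) (R : ℕ) : Prop :=
  ∀ n, RootedSandwichWitness Z n → 3 ^ n ≤ (R + 1) * 2 ^ n

/-- ★ PROVED: a witness of dimension `n` prices every EF of `Z`: `3^n ≤ (r+1)·2^n`
(`HasEFOfSize.inter_eqs` for the flat, `HasEFOfSize.image_linearMap` for the map, then the sandwich). -/
theorem three_pow_le_of_witness {ι : Type} [Fintype ι] {Z : Set (ι → ℝ)} {n r : ℕ}
    (hW : RootedSandwichWitness Z n) (hZ : HasEFOfSize Z r) : 3 ^ n ≤ (r + 1) * 2 ^ n := by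
  obtain ⟨k, cv, δ, L, hpts, hsub⟩ := hW
  exact sandwich_three_pow_le hpts hsub ((hZ.inter_eqs cv δ).image_linearMap L)

/-- ★ THE SCHEMA (kernel sentence): a fan-expensive set is not budgeted — `CovZonoHard` holds for every fan-expensive covering zonotope. -/
theorem not_hasEF_of_fanExpensive {ι : Type} [Fintype ι] {Z : Set (ι → ℝ)} {R : ℕ}
    (h : FanExpensiveBeyond Z R) : ¬ HasEFOfSize Z R := fun hZ => by
  obtain ⟨n, hlt, hW⟩ := h
  exact absurd (three_pow_le_of_witness hW hZ) (not_le.mpr hlt)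

/-- ★ N13 in kernel: every budgeted set is fan-cheap up to its budget (so a residual enemy of the zonotope chapter is fan-cheap at
every located level — the contrapositive reading of the schema). -/
theorem fanCheap_of_hasEF {ι : Type} [Fintype ι] {Z : Set (ι → ℝ)} {R : ℕ} (hZ : HasEFOfSize Z R) : FanCheapUpTo Z R :=
  fun _ hW => three_pow_le_of_witness hW hZ

/-- sanity instance: `Z_full(n+1)` carries the trivial witness (no equations, identity map). -/
theorem zFull_witness (n : ℕ) : RootedSandwichWitness (zFull (n + 1)) n := by
  refine ⟨0, Fin.elim0, Fin.elim0, LinearMap.id, fun b => ⟨vPt b, ⟨vPt_mem_zFull b, fun t => t.elim0⟩, rfl⟩, ?_⟩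
  rintro _ ⟨x, ⟨hx, -⟩, rfl⟩
  exact zFull_subset_cliqueCone (n + 1) hx

/-- hence `Z_full(n+1)` is fan-expensive beyond every `R` with `(R+1)·2^n < 3^n`. -/
theorem zFull_fanExpensive {n R : ℕ} (h : (R + 1) * 2 ^ n < 3 ^ n) : FanExpensiveBeyond (zFull (n + 1)) R :=
  ⟨n, h, zFull_witness n⟩


/-! ## 10. P-R2a — kernel: the antitone cone has an explicit slack-form EF of size `2h² + h`
(variables `u_xt ≥ 0`, slacks `s_xt = u_xt − W_xt ≥ 0`, row slacks `σ_x = −(W_xx + 2Σ_t u_xt) ≥ 0`; rows: symmetry, domination, row sums). -/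

section antitoneEF

/-- symmetry rows: `(Esym W)(p,q) = W(p,q) − W(q,p)`. -/
def Esym (h : ℕ) : Matrix (Fin h × Fin h) (Fin h × Fin h) ℝ :=
  Matrix.of fun r c => (if c = r then (1:ℝ) else 0) - (if c = (r.2, r.1) then 1 else 0)

/-- diagonal-extraction rows: `(Erow W) x = W(x,x)`. -/
def Erow (h : ℕ) : Matrix (Fin h) (Fin h × Fin h) ℝ := Matrix.of fun x c => if c = (x, x) then (1:ℝ) else 0

/-- row sums of the dominating variables: `(U2 u) x = 2·Σ_t u(x,t)`. -/
def U2 (h : ℕ) : Matrix (Fin h) (Fin h × Fin h) ℝ := Matrix.of fun x c => if c.1 = x then (2:ℝ) else 0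

theorem Esym_mulVec_apply (W : Fin h × Fin h → ℝ) (r : Fin h × Fin h) :
    (Esym h *ᵥ W) r = W r - W (r.2, r.1) := by
  classical
  simp [Esym, Matrix.mulVec, dotProduct, sub_mul, Finset.sum_sub_distrib, ite_mul, Finset.sum_ite_eq']

theorem Erow_mulVec_apply (W : Fin h × Fin h → ℝ) (x : Fin h) : (Erow h *ᵥ W) x = W (x, x) := by
  classical
  simp [Erow, Matrix.mulVec, dotProduct, ite_mul, Finset.sum_ite_eq']

theorem U2_mulVec_apply (u : Fin h × Fin h → ℝ) (x : Fin h) : (U2 h *ᵥ u) x = 2 * ∑ t, u (x, t) := by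
  classical
  simp only [U2, Matrix.mulVec, dotProduct, Matrix.of_apply, Fintype.sum_prod_type]
  rw [Finset.sum_eq_single x (fun a _ ha => by simp [ha]) (by simp)]
  simp [Finset.mul_sum]

/-- the natural-variable matrix of the system. -/
def antiE (h : ℕ) : Matrix ((Fin h × Fin h) ⊕ ((Fin h × Fin h) ⊕ Fin h)) (Fin h × Fin h) ℝ :=
  Matrix.fromRows (Esym h) (Matrix.fromRows 1 (Erow h))

/-- the slack-variable matrix of the system (columns: `u`, `s`, `σ`). -/
def antiF (h : ℕ) :
    Matrix ((Fin h × Fin h) ⊕ ((Fin h × Fin h) ⊕ Fin h)) ((Fin h × Fin h) ⊕ ((Fin h × Fin h) ⊕ Fin h)) ℝ :=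
  Matrix.fromRows 0 (Matrix.fromRows (Matrix.fromCols (-1) (Matrix.fromCols 1 0))
    (Matrix.fromCols (U2 h) (Matrix.fromCols 0 1)))

theorem anti_row₁ (W : Fin h × Fin h → ℝ) (y : (Fin h × Fin h) ⊕ ((Fin h × Fin h) ⊕ Fin h) → ℝ) (r : Fin h × Fin h) :
    (antiE h *ᵥ W + antiF h *ᵥ y) (Sum.inl r) = W r - W (r.2, r.1) := by
  simp [antiE, antiF, Matrix.fromRows_mulVec, Esym_mulVec_apply]

theorem anti_row₂ (W : Fin h × Fin h → ℝ) (y : (Fin h × Fin h) ⊕ ((Fin h × Fin h) ⊕ Fin h) → ℝ) (c : Fin h × Fin h) :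
    (antiE h *ᵥ W + antiF h *ᵥ y) (Sum.inr (Sum.inl c)) = W c - y (Sum.inl c) + y (Sum.inr (Sum.inl c)) := by
  simp [antiE, antiF, Matrix.fromRows_mulVec, Matrix.fromBlocks_mulVec, Matrix.neg_mulVec]
  ring

theorem anti_row₃ (W : Fin h × Fin h → ℝ) (y : (Fin h × Fin h) ⊕ ((Fin h × Fin h) ⊕ Fin h) → ℝ) (x : Fin h) :
    (antiE h *ᵥ W + antiF h *ᵥ y) (Sum.inr (Sum.inr x))
      = W (x, x) + 2 * ∑ t, y (Sum.inl (x, t)) + y (Sum.inr (Sum.inr x)) := by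
  simp [antiE, antiF, Matrix.fromRows_mulVec, Matrix.fromBlocks_mulVec, Erow_mulVec_apply, U2_mulVec_apply]
  ring

theorem max_zero_eq_ite (a : ℝ) : max a 0 = if 0 < a then a else 0 := by
  split_ifs with ha
  · exact max_eq_left ha.le
  · exact max_eq_right (not_lt.mp ha)

/-- ★ the antitone cone IS the projection of the slack-form system. -/
theorem antitoneCone_eq_system (h : ℕ) :
    antitoneCone h = {W | ∃ y : (Fin h × Fin h) ⊕ ((Fin h × Fin h) ⊕ Fin h) → ℝ,
      (∀ j, 0 ≤ y j) ∧ antiE h *ᵥ W + antiF h *ᵥ y = 0} := by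
  classical
  ext W
  simp only [antitoneCone, Set.mem_setOf_eq]
  constructor
  · rintro ⟨hsym, hanti⟩
    have hdiag : ∀ x, W (x, x) ≤ 0 := fun x => by simpa using hanti x ∅ (by simp)
    refine ⟨Sum.elim (fun c => max (W c) 0) (Sum.elim (fun c => max (W c) 0 - W c)
      (fun x => -(W (x, x) + 2 * ∑ t, max (W (x, t)) 0))), ?_, ?_⟩
    · rintro (c | c | x)
      · simp
      · simp
      · simp only [Sum.elim_inr, neg_nonneg]
        have hsum : ∑ t, max (W (x, t)) 0 = ∑ t ∈ Finset.univ.filter (fun t => 0 < W (x, t)), W (x, t) := by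
          rw [Finset.sum_filter]
          exact Finset.sum_congr rfl fun t _ => max_zero_eq_ite _
        have hx : x ∉ Finset.univ.filter (fun t => 0 < W (x, t)) := by simp [not_lt.mpr (hdiag x)]
        have := hanti x _ hx
        linarith [hsum]
    · funext i
      rcases i with r | c | x
      · rw [anti_row₁]; simp [hsym r.1 r.2]
      · rw [anti_row₂]; simp
      · rw [anti_row₃]; simp
  · rintro ⟨y, hy, hsys⟩
    have e₁ : ∀ r : Fin h × Fin h, W r - W (r.2, r.1) = 0 := fun r => by
      have := congrFun hsys (Sum.inl r); rwa [anti_row₁] at this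
    have e₂ : ∀ c : Fin h × Fin h, W c - y (Sum.inl c) + y (Sum.inr (Sum.inl c)) = 0 := fun c => by
      have := congrFun hsys (Sum.inr (Sum.inl c)); rwa [anti_row₂] at this
    have e₃ : ∀ x : Fin h, W (x, x) + 2 * ∑ t, y (Sum.inl (x, t)) + y (Sum.inr (Sum.inr x)) = 0 := fun x => by
      have := congrFun hsys (Sum.inr (Sum.inr x)); rwa [anti_row₃] at this
    refine ⟨fun p q => by linarith [e₁ (p, q)], fun x T hxT => ?_⟩
    have hdom : ∀ t, W (x, t) ≤ y (Sum.inl (x, t)) := fun t => by linarith [e₂ (x, t), hy (Sum.inr (Sum.inl (x, t)))]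
    have h1 : ∑ t ∈ T, W (x, t) ≤ ∑ t ∈ T, y (Sum.inl (x, t)) := Finset.sum_le_sum fun t _ => hdom t
    have h2 : ∑ t ∈ T, y (Sum.inl (x, t)) ≤ ∑ t, y (Sum.inl (x, t)) :=
      Finset.sum_le_sum_of_subset_of_nonneg (Finset.subset_univ T) fun t _ _ => hy _
    linarith [e₃ x, hy (Sum.inr (Sum.inr x))]

/-- ★ PROVED (P-R2a): the antitone cone has a slack-form EF of size `h² + (h² + h) = 2h² + h`. -/
theorem antitoneCone_hasEF (h : ℕ) : HasEFOfSize (antitoneCone h) (2 * h * h + h) := by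
  classical
  have h0 := Literature.Barriers.PneNP.hasEFOfSize_of_system (ι := Fin h × Fin h) (antiE h) (antiF h) 0
  rw [← antitoneCone_eq_system] at h0
  simp only [Fintype.card_sum, Fintype.card_prod, Fintype.card_fin] at h0
  convert h0 using 1
  ring

/-- ★ `AntitoneConeCheap` HOLDS. -/
theorem antitoneConeCheap_holds : AntitoneConeCheap := antitoneCone_hasEF


/-- ★ PROVED (P-R2a, «polar = the pairing identity», generator level): a symmetric `W` is ANTITONE iff it prices every corona
generator `P_{A∪B} − P_B` (`A, B` disjoint) nonpositively — `⟸` by the singleton generators `A = {x}`, `⟹` by telescoping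
(`qf_union_le`).  Composed with the finite bipolar theorem for the finitely generated cone `coronaCone h` this is exactly
`CoronaConePolarAntitone`; that Farkas step is the only part of (C3) left typed. -/
theorem antitone_iff_generators_nonpos (W : Fin h × Fin h → ℝ) (hW : ∀ p q, W (p, q) = W (q, p)) :
    W ∈ antitoneCone h ↔ ∀ A B : Finset (Fin h), Disjoint A B → W ⬝ᵥ coronaKernel A B ≤ 0 := by
  classical
  constructor
  · intro hA A B hAB
    rw [dot_coronaKernel]
    linarith [qf_union_le W hA A B hAB]
  · intro hgen
    refine ⟨hW, fun x T hxT => ?_⟩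
    have h1 := hgen {x} T (Finset.disjoint_singleton_left.mpr hxT)
    rw [dot_coronaKernel, ← Finset.insert_eq, qf_insert W hW hxT] at h1
    linarith

end antitoneEF


/-! ## 11. (C3) closed in kernel — the corona cone is EXACTLY the polar of the antitone cone (Farkas half via the in-tree
conic Farkas lemma `Literature.Barriers.PneNP.farkas`) -/

section polar

theorem corVec_top_symm {m : ℕ} (b : Fin m → Bool) (p q : Fin m) :
    corVec (⊤ : SimpleGraph (Fin m)) b (p, q) = corVec (⊤ : SimpleGraph (Fin m)) b (q, p) := by
  rw [corVec_top_apply, corVec_top_apply, mul_comm]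

theorem coronaKernel_symm (A B : Finset (Fin h)) (p q : Fin h) :
    coronaKernel A B (p, q) = coronaKernel A B (q, p) := by
  simp only [coronaKernel, Pi.sub_apply, corVec_top_symm]

theorem coronaKernel_empty (B : Finset (Fin h)) : coronaKernel (∅ : Finset (Fin h)) B = 0 := by
  simp [coronaKernel]

/-- symmetrisation `(y + yᵀ)/2`. -/
def symz (y : Fin h × Fin h → ℝ) : Fin h × Fin h → ℝ := fun pq => (y pq + y (pq.2, pq.1)) / 2

theorem symz_symm (y : Fin h × Fin h → ℝ) (p q : Fin h) : symz y (p, q) = symz y (q, p) := by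
  simp only [symz]; ring

theorem symz_dot_of_symm (y v : Fin h × Fin h → ℝ) (hv : ∀ p q, v (p, q) = v (q, p)) :
    symz y ⬝ᵥ v = y ⬝ᵥ v := by
  have hswap : ∑ pq : Fin h × Fin h, y (pq.2, pq.1) * v pq = ∑ pq : Fin h × Fin h, y pq * v pq := by
    calc ∑ pq : Fin h × Fin h, y (pq.2, pq.1) * v pq
        = ∑ pq : Fin h × Fin h, (fun pq : Fin h × Fin h => y pq * v (pq.2, pq.1)) (Equiv.prodComm (Fin h) (Fin h) pq) := rfl
      _ = ∑ pq : Fin h × Fin h, y pq * v (pq.2, pq.1) :=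
          Equiv.sum_comp (Equiv.prodComm (Fin h) (Fin h)) (fun pq : Fin h × Fin h => y pq * v (pq.2, pq.1))
      _ = ∑ pq : Fin h × Fin h, y pq * v pq := Fintype.sum_congr _ _ fun pq => by rw [← hv pq.1 pq.2]
  have hsplit : ∑ pq : Fin h × Fin h, (y pq + y (pq.2, pq.1)) / 2 * v pq
      = (∑ pq : Fin h × Fin h, y pq * v pq) / 2 + (∑ pq : Fin h × Fin h, y (pq.2, pq.1) * v pq) / 2 := by
    rw [Finset.sum_div, Finset.sum_div, ← Finset.sum_add_distrib]
    exact Finset.sum_congr rfl fun pq _ => by ring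
  simp only [dotProduct, symz]
  rw [hsplit, hswap]
  ring

/-- ★ PROVED (the Farkas half of (C3)): a symmetric `x` that every antitone `W` prices nonpositively lies in the corona cone. -/
theorem mem_coronaCone_of_polar {x : Fin h × Fin h → ℝ} (hx : ∀ p q, x (p, q) = x (q, p))
    (hpol : ∀ W ∈ antitoneCone h, ∑ p, W p * x p ≤ 0) : x ∈ coronaCone h := by
  classical
  let a : Finset (Fin h) × Finset (Fin h) → (Fin h × Fin h → ℝ) := fun AB =>
    if AB.1 = ∅ ∨ ¬ Disjoint AB.1 AB.2 then 0 else coronaKernel AB.1 AB.2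
  rcases Literature.Barriers.PneNP.farkas a x with ⟨lam, hlam, hxlam⟩ | ⟨y, hy, hxy⟩
  · refine ⟨fun AB => if AB.1 = ∅ ∨ ¬ Disjoint AB.1 AB.2 then 0 else lam AB, fun AB => ?_, fun AB hAB => ?_, ?_⟩
    · dsimp only
      split_ifs
      · exact le_rfl
      · exact hlam AB
    · dsimp only
      rw [if_pos hAB]
    · funext v
      rw [hxlam v, Finset.sum_apply]
      refine Finset.sum_congr rfl fun AB _ => ?_
      simp only [Pi.smul_apply, smul_eq_mul, a]
      split_ifs <;> simp
  · exfalso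
    have hWsym : ∀ p q, (-symz y) (p, q) = (-symz y) (q, p) := fun p q => by
      simp only [Pi.neg_apply, symz_symm y p q]
    have hW : -symz y ∈ antitoneCone h := by
      rw [antitone_iff_generators_nonpos _ hWsym]
      intro A B hAB
      rw [neg_dotProduct, symz_dot_of_symm _ _ (coronaKernel_symm A B), neg_nonpos]
      by_cases hA : A = ∅
      · subst hA; simp [coronaKernel_empty]
      · have := hy (A, B)
        simp [a, hA, hAB] at this
        rwa [dotProduct_comm] at this
    have h1 := hpol _ hW
    have h2 : ∑ p, (-symz y) p * x p = -(x ⬝ᵥ y) := by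
      rw [show (∑ p, (-symz y) p * x p) = (-symz y) ⬝ᵥ x from rfl, neg_dotProduct,
        symz_dot_of_symm _ _ hx, dotProduct_comm]
    linarith

/-- ★ `CoronaConePolarAntitone` HOLDS — (C3) is a kernel theorem: the apex normal chamber of the corona-covering zonotope is
EXACTLY the antitone cone (containment half `antitone_dot_corona_nonpos`, rev 3; Farkas half `mem_coronaCone_of_polar`, rev 6). -/
theorem coronaConePolarAntitone_holds : CoronaConePolarAntitone := by
  intro h x hx
  exact ⟨fun hxC W hW => antitone_dot_corona_nonpos hW hxC, mem_coronaCone_of_polar hx⟩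

end polar


/-! ## 12. The corona cone ITSELF is cheap: an explicit EF of size `2h² + h` (the LP dual of §10: `x_pq = (d_pq + d_qp)/2 + [p=q]·ρ_p`,
`0 ≤ d_pq ≤ 2ρ_p`, `ρ_p ≥ 0`). -/

section coronaEF

/-- the row bracket of an antitone `W` with ALL positive parts is nonpositive. -/
theorem antitone_row_max_le {W : Fin h × Fin h → ℝ} (hW : W ∈ antitoneCone h) (x : Fin h) :
    W (x, x) + 2 * ∑ t, max (W (x, t)) 0 ≤ 0 := by
  classical
  have hdiag : W (x, x) ≤ 0 := by simpa using hW.2 x ∅ (by simp)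
  have hsum : ∑ t, max (W (x, t)) 0 = ∑ t ∈ Finset.univ.filter (fun t => 0 < W (x, t)), W (x, t) := by
    rw [Finset.sum_filter]
    exact Finset.sum_congr rfl fun t _ => max_zero_eq_ite _
  have hx : x ∉ Finset.univ.filter (fun t => 0 < W (x, t)) := by simp [not_lt.mpr hdiag]
  have := hW.2 x _ hx
  linarith [hsum]

/-- `u_{A,B}(p) = 𝟙[p ∈ (A∪B)∖B]` and `b_B(p) = 𝟙[p ∈ B]` as reals. -/
def uu (AB : Finset (Fin h) × Finset (Fin h)) (p : Fin h) : ℝ := chi (ind (AB.1 ∪ AB.2)) p - chi (ind AB.2) p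
def bb (AB : Finset (Fin h) × Finset (Fin h)) (p : Fin h) : ℝ := chi (ind AB.2) p

theorem chi_mul_self {m : ℕ} (b : Fin m → Bool) (p : Fin m) : chi b p * chi b p = chi b p := by
  unfold chi; split_ifs <;> simp

theorem coronaKernel_apply' (AB : Finset (Fin h) × Finset (Fin h)) (p q : Fin h) :
    coronaKernel AB.1 AB.2 (p, q) = uu AB p * uu AB q + uu AB p * bb AB q + uu AB q * bb AB p := by
  simp only [coronaKernel, Pi.sub_apply, corVec_top_apply, uu, bb]
  ring

theorem coronaKernel_diag (AB : Finset (Fin h) × Finset (Fin h)) (p : Fin h) :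
    coronaKernel AB.1 AB.2 (p, p) = uu AB p := by
  simp only [coronaKernel, Pi.sub_apply, corVec_top_apply, chi_mul_self, uu]

theorem uu_cases (AB : Finset (Fin h) × Finset (Fin h)) (p : Fin h) :
    (uu AB p = 0 ∨ uu AB p = 1) ∧ (bb AB p = 0 ∨ bb AB p = 1) ∧ uu AB p + 2 * bb AB p ≤ 2 := by
  simp only [uu, bb, chi_ind, Finset.mem_union]
  by_cases h2 : p ∈ AB.2 <;> by_cases h1 : p ∈ AB.1 <;> simp [h1, h2]

theorem uu_nonneg (AB : Finset (Fin h) × Finset (Fin h)) (p : Fin h) : 0 ≤ uu AB p := by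
  rcases (uu_cases AB p).1 with h0 | h1
  · rw [h0]
  · rw [h1]; exact zero_le_one

theorem bb_nonneg (AB : Finset (Fin h) × Finset (Fin h)) (p : Fin h) : 0 ≤ bb AB p := by
  rcases (uu_cases AB p).2.1 with h0 | h1
  · rw [h0]
  · rw [h1]; exact zero_le_one

/-- the dual slack matrices.  Slack variables `(d, e, ρ)` indexed by `P ⊕ (P ⊕ Fin h)`; rows `P ⊕ P`:
row₁ `(p,q)`: `x_pq − (d_pq + d_qp)/2 − [p = q]·ρ_p = 0`; row₂ `(p,q)`: `d_pq + e_pq − 2ρ_p = 0`. -/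
def Dhalf (h : ℕ) : Matrix (Fin h × Fin h) (Fin h × Fin h) ℝ :=
  Matrix.of fun r c => -((if c = r then (1:ℝ) / 2 else 0) + (if c = (r.2, r.1) then 1 / 2 else 0))

def DiagSel (h : ℕ) : Matrix (Fin h × Fin h) (Fin h) ℝ := Matrix.of fun r p => if r.1 = p ∧ r.2 = p then (-1:ℝ) else 0

def RowSel2 (h : ℕ) : Matrix (Fin h × Fin h) (Fin h) ℝ := Matrix.of fun r p => if r.1 = p then (-2:ℝ) else 0

def corE (h : ℕ) : Matrix ((Fin h × Fin h) ⊕ (Fin h × Fin h)) (Fin h × Fin h) ℝ := Matrix.fromRows 1 0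

def corF (h : ℕ) :
    Matrix ((Fin h × Fin h) ⊕ (Fin h × Fin h)) ((Fin h × Fin h) ⊕ ((Fin h × Fin h) ⊕ Fin h)) ℝ :=
  Matrix.fromRows (Matrix.fromCols (Dhalf h) (Matrix.fromCols 0 (DiagSel h)))
    (Matrix.fromCols 1 (Matrix.fromCols 1 (RowSel2 h)))

theorem Dhalf_mulVec_apply (d : Fin h × Fin h → ℝ) (r : Fin h × Fin h) :
    (Dhalf h *ᵥ d) r = -((d r + d (r.2, r.1)) / 2) := by
  classical
  simp [Dhalf, Matrix.mulVec, dotProduct, add_mul, Finset.sum_add_distrib, ite_mul, Finset.sum_ite_eq',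
    Finset.sum_neg_distrib]
  ring

theorem DiagSel_mulVec_apply (ρ : Fin h → ℝ) (r : Fin h × Fin h) :
    (DiagSel h *ᵥ ρ) r = -(if r.2 = r.1 then ρ r.1 else 0) := by
  classical
  simp only [DiagSel, Matrix.mulVec, dotProduct, Matrix.of_apply]
  rw [Finset.sum_eq_single r.1 (fun p _ hp => by simp [Ne.symm hp]) (by simp)]
  by_cases h21 : r.2 = r.1 <;> simp [h21]

theorem RowSel2_mulVec_apply (ρ : Fin h → ℝ) (r : Fin h × Fin h) : (RowSel2 h *ᵥ ρ) r = -(2 * ρ r.1) := by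
  classical
  simp [RowSel2, Matrix.mulVec, dotProduct, ite_mul, Finset.sum_ite_eq]

theorem cor_row₁ (x : Fin h × Fin h → ℝ) (y : (Fin h × Fin h) ⊕ ((Fin h × Fin h) ⊕ Fin h) → ℝ) (r : Fin h × Fin h) :
    (corE h *ᵥ x + corF h *ᵥ y) (Sum.inl r)
      = x r - (y (Sum.inl r) + y (Sum.inl (r.2, r.1))) / 2 - (if r.2 = r.1 then y (Sum.inr (Sum.inr r.1)) else 0) := by
  simp [corE, corF, Matrix.fromRows_mulVec, Matrix.fromBlocks_mulVec, Dhalf_mulVec_apply, DiagSel_mulVec_apply]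
  ring

theorem cor_row₂ (x : Fin h × Fin h → ℝ) (y : (Fin h × Fin h) ⊕ ((Fin h × Fin h) ⊕ Fin h) → ℝ) (r : Fin h × Fin h) :
    (corE h *ᵥ x + corF h *ᵥ y) (Sum.inr r) = y (Sum.inl r) + y (Sum.inr (Sum.inl r)) - 2 * y (Sum.inr (Sum.inr r.1)) := by
  simp [corE, corF, Matrix.fromRows_mulVec, Matrix.fromBlocks_mulVec, RowSel2_mulVec_apply]
  ring


/-- ★ the corona cone IS the projection of the explicit dual system. -/
theorem coronaCone_eq_dualSystem (h : ℕ) :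
    coronaCone h = {x | ∃ y : (Fin h × Fin h) ⊕ ((Fin h × Fin h) ⊕ Fin h) → ℝ,
      (∀ j, 0 ≤ y j) ∧ corE h *ᵥ x + corF h *ᵥ y = 0} := by
  classical
  ext x
  constructor
  · rintro ⟨μ, hμ, hbad, rfl⟩
    let ρ : Fin h → ℝ := fun p => ∑ AB, μ AB * uu AB p
    let d : Fin h × Fin h → ℝ := fun c =>
      if c.2 = c.1 then 0 else ∑ AB, μ AB * (uu AB c.1 * uu AB c.2 + 2 * (uu AB c.1 * bb AB c.2))
    have hρ : ∀ p, 0 ≤ ρ p := fun p => Finset.sum_nonneg fun AB _ => mul_nonneg (hμ AB) (uu_nonneg AB p)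
    have hd : ∀ c, 0 ≤ d c := fun c => by
      by_cases hc : c.2 = c.1
      · simp only [d, hc, if_true]; exact le_rfl
      · simp only [d, hc, if_false]
        exact Finset.sum_nonneg fun AB _ => mul_nonneg (hμ AB)
          (by nlinarith [uu_nonneg AB c.1, uu_nonneg AB c.2, bb_nonneg AB c.2, mul_nonneg (uu_nonneg AB c.1) (uu_nonneg AB c.2),
            mul_nonneg (uu_nonneg AB c.1) (bb_nonneg AB c.2)])
    have hdle : ∀ c, d c ≤ 2 * ρ c.1 := fun c => by
      by_cases hc : c.2 = c.1
      · simp only [d, hc, if_true]; exact mul_nonneg zero_le_two (hρ c.1)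
      · simp only [d, hc, if_false, ρ]
        rw [Finset.mul_sum]
        refine Finset.sum_le_sum fun AB _ => ?_
        have h2 := (uu_cases AB c.2).2.2
        nlinarith [hμ AB, uu_nonneg AB c.1, mul_nonneg (hμ AB) (uu_nonneg AB c.1)]
    refine ⟨Sum.elim d (Sum.elim (fun c => 2 * ρ c.1 - d c) ρ), ?_, ?_⟩
    · rintro (c | c | p)
      · exact hd c
      · show 0 ≤ 2 * ρ c.1 - d c
        linarith [hdle c]
      · exact hρ p
    · funext i
      rcases i with r | r
      · rw [cor_row₁, Finset.sum_apply]
        simp only [Sum.elim_inl, Sum.elim_inr, Pi.zero_apply, Pi.smul_apply, smul_eq_mul]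
        obtain ⟨p, q⟩ := r
        simp only
        by_cases hpq : q = p
        · subst hpq
          simp [d, ρ, coronaKernel_diag]
        · have hqp : ¬ p = q := fun h' => hpq h'.symm
          simp only [d, hpq, hqp, if_false, sub_zero]
          rw [← Finset.sum_add_distrib, Finset.sum_div, ← Finset.sum_sub_distrib]
          refine Finset.sum_eq_zero fun AB _ => ?_
          rw [coronaKernel_apply']
          ring
      · rw [cor_row₂]
        simp only [Sum.elim_inl, Sum.elim_inr, Pi.zero_apply]
        ring
  · rintro ⟨y, hy, hsys⟩
    have e₁ : ∀ r : Fin h × Fin h, x r = (y (Sum.inl r) + y (Sum.inl (r.2, r.1))) / 2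
        + (if r.2 = r.1 then y (Sum.inr (Sum.inr r.1)) else 0) := fun r => by
      have := congrFun hsys (Sum.inl r)
      rw [cor_row₁] at this
      simp only [Pi.zero_apply] at this
      linarith
    have e₂ : ∀ r : Fin h × Fin h, y (Sum.inl r) ≤ 2 * y (Sum.inr (Sum.inr r.1)) := fun r => by
      have := congrFun hsys (Sum.inr r)
      rw [cor_row₂] at this
      simp only [Pi.zero_apply] at this
      linarith [hy (Sum.inr (Sum.inl r))]
    have hxsym : ∀ p q, x (p, q) = x (q, p) := fun p q => by
      rw [e₁ (p, q), e₁ (q, p)]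
      simp only
      by_cases hpq : q = p
      · subst hpq; simp
      · have hqp : ¬ p = q := fun h' => hpq h'.symm
        simp only [hpq, hqp, if_false]
        ring
    refine mem_coronaCone_of_polar hxsym fun W hW => ?_
    have hWsym := hW.1
    set ρ : Fin h → ℝ := fun p => y (Sum.inr (Sum.inr p)) with hρdef
    set d : Fin h × Fin h → ℝ := fun c => y (Sum.inl c) with hddef
    have hx' : ∀ c : Fin h × Fin h, x c = (d c + d (c.2, c.1)) / 2 + (if c.2 = c.1 then ρ c.1 else 0) := fun c => e₁ c
    have hswap : ∑ c : Fin h × Fin h, W c * d (c.2, c.1) = ∑ c : Fin h × Fin h, W c * d c := by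
      calc ∑ c : Fin h × Fin h, W c * d (c.2, c.1)
          = ∑ c : Fin h × Fin h, (fun c : Fin h × Fin h => W (c.2, c.1) * d c) (Equiv.prodComm (Fin h) (Fin h) c) := rfl
        _ = ∑ c : Fin h × Fin h, W (c.2, c.1) * d c :=
          Equiv.sum_comp (Equiv.prodComm (Fin h) (Fin h)) (fun c : Fin h × Fin h => W (c.2, c.1) * d c)
        _ = ∑ c : Fin h × Fin h, W c * d c := Fintype.sum_congr _ _ fun c => by rw [hWsym c.2 c.1]
    have hdiag : ∑ c : Fin h × Fin h, W c * (if c.2 = c.1 then ρ c.1 else 0) = ∑ p, W (p, p) * ρ p := by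
      rw [Fintype.sum_prod_type]
      refine Fintype.sum_congr _ _ fun p => ?_
      rw [Finset.sum_eq_single p (fun q _ hq => by simp [hq]) (by simp)]
      simp
    have step1 : ∑ c, W c * x c = ∑ c : Fin h × Fin h, W c * d c + ∑ p, W (p, p) * ρ p := by
      calc ∑ c, W c * x c
          = ∑ c : Fin h × Fin h, (W c * d c / 2 + W c * d (c.2, c.1) / 2 + W c * (if c.2 = c.1 then ρ c.1 else 0)) :=
            Fintype.sum_congr _ _ fun c => by rw [hx' c]; ring
        _ = (∑ c : Fin h × Fin h, W c * d c) / 2 + (∑ c : Fin h × Fin h, W c * d (c.2, c.1)) / 2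
              + ∑ c : Fin h × Fin h, W c * (if c.2 = c.1 then ρ c.1 else 0) := by
            rw [Finset.sum_add_distrib, Finset.sum_add_distrib, Finset.sum_div, Finset.sum_div]
        _ = ∑ c : Fin h × Fin h, W c * d c + ∑ p, W (p, p) * ρ p := by rw [hswap, hdiag]; ring
    rw [step1, Fintype.sum_prod_type, ← Finset.sum_add_distrib]
    refine Finset.sum_nonpos fun p _ => ?_
    have hρp : 0 ≤ ρ p := hy _
    have hrow : ∑ q, W (p, q) * d (p, q) ≤ 2 * ρ p * ∑ q, max (W (p, q)) 0 := by
      rw [Finset.mul_sum]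
      refine Finset.sum_le_sum fun q _ => ?_
      have hdq : 0 ≤ d (p, q) := hy _
      have hdle : d (p, q) ≤ 2 * ρ p := e₂ (p, q)
      calc W (p, q) * d (p, q) ≤ max (W (p, q)) 0 * d (p, q) := mul_le_mul_of_nonneg_right (le_max_left _ _) hdq
        _ ≤ max (W (p, q)) 0 * (2 * ρ p) := mul_le_mul_of_nonneg_left hdle (le_max_right _ _)
        _ = 2 * ρ p * max (W (p, q)) 0 := by ring
    have hbr := antitone_row_max_le hW p
    nlinarith [hrow, hbr, hρp, mul_nonpos_iff.mpr (Or.inl ⟨hρp, hbr⟩)]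

/-- ★ PROVED: the corona cone has a slack-form EF of size `h² + (h² + h) = 2h² + h`. -/
theorem coronaCone_hasEF (h : ℕ) : HasEFOfSize (coronaCone h) (2 * h * h + h) := by
  classical
  have h0 := Literature.Barriers.PneNP.hasEFOfSize_of_system (ι := Fin h × Fin h) (corE h) (corF h) 0
  rw [← coronaCone_eq_dualSystem] at h0
  simp only [Fintype.card_sum, Fintype.card_prod, Fintype.card_fin] at h0
  convert h0 using 1
  ring

/-- ★ `ZCorApexConeCheap` HOLDS: the apex cone of the corona-covering zonotope has `xc ≤ 2h² + h` — the LOCALITY WALL in kernel. -/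
theorem zCorApexConeCheap_holds : ZCorApexConeCheap := coronaCone_hasEF

end coronaEF


/-! ## 13. Loose end: the UNROOTED clique cone is hard too (2-line corollary of the sandwich — the BFPS functionals are nonpositive on
the whole unrooted cone, so no face argument is needed). -/

/-- ★ `CliqueConeHard` HOLDS. -/
theorem cliqueConeHard_holds : CliqueConeHard := fun n _r hEF =>
  sandwich_three_pow_le (fun b => zFull_subset_cliqueCone (n + 1) (vPt_mem_zFull b)) subset_rfl hEF


/-! ## 14. (C4) THE BALANCED FACE — 41's SIZE-MATCHED `Z_cor` is NOT budgeted (unconditional, kernel).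
`Z_cor(h) = Σ [0,1]·g_{A,B}` over disjoint pairs with `|A| = |B| ≥ 1`, `A ∪ B ≠ [h]` (val-idea-41 rev 1.7 (E4.5)). For the block
`R = {p < n+1}` (`2n+3 ≤ h`) the functional `W_R = −2·J_R + (𝟙_R𝟙_{Rᶜ}ᵀ + 𝟙_{Rᶜ}𝟙_Rᵀ) − (6(n+1)+1)·I_{Rᶜ}` prices every zone
nonpositively — with `a = |A∩R|, a′ = |A∖R|, b = |B∩R|`: `⟨W_R, g_{A,B}⟩ = 4aa′ − 6ab + 2a′b − (6(n+1)+1)a′ ≤ −a′ − 6ab` — and is tight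
exactly on the zones `A ⊆ R, B ⊆ Rᶜ`, whose `R × R` blocks are the clique matrices `P_A`.  The BFPS functionals on the block plus `λ·W_R`
(`λ = (h(n+1))²`) then run the UDISJ pattern on `Z_cor` ITSELF: `3^n ≤ (xc+1)·2^n`, i.e. `xc(Z_cor(h)) ≥ 1.5^{⌊(h−3)/2⌋} − 1`.
(The size-matching is essential: on the unrestricted `Z'_cor` the term `2ab′` is unbounded, `W_R` is not in the polar, and §12 shows
the apex cone is cheap.) -/

/-- size-matched admissible pairs = the zones of 41's `Z_cor`. -/
def SmAdm (A B : Finset (Fin h)) : Prop :=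
  Disjoint A B ∧ A.card = B.card ∧ 1 ≤ A.card ∧ A ∪ B ≠ Finset.univ

/-- 41's size-matched corona zonotope `Z_cor(h) = Σ_{(A,B) size-matched admissible} [0,1]·g_{A,B}`. -/
def zCorSM (h : ℕ) : Set (Fin h × Fin h → ℝ) :=
  {x | ∃ μ : Finset (Fin h) × Finset (Fin h) → ℝ, (∀ AB, 0 ≤ μ AB ∧ μ AB ≤ 1) ∧ (∀ AB, ¬ SmAdm AB.1 AB.2 → μ AB = 0) ∧
    x = ∑ AB, μ AB • coronaKernel AB.1 AB.2}

/-- ★ (C4) statement: `Z_cor` is exponentially far from budgeted. -/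
def ZCorSMUnbudgeted : Prop :=
  ∀ (n h r : ℕ), 2 * n + 3 ≤ h → HasEFOfSize (zCorSM h) r → 3 ^ n ≤ (r + 1) * 2 ^ n

/-- the balanced-face functional `W_R` for the block `R = {p < m}`. -/
def wR (h m : ℕ) : Fin h × Fin h → ℝ := fun pq =>
  if (pq.1 : ℕ) < m ∧ (pq.2 : ℕ) < m then -2
  else if (pq.1 : ℕ) < m ∨ (pq.2 : ℕ) < m then 1
  else if pq.1 = pq.2 then -(6 * (m : ℝ) + 1) else 0

/-- block counts `|S ∩ R|`, `|S ∖ R|` as reals. -/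
def cR (m : ℕ) (S : Finset (Fin h)) : ℝ := ((S.filter fun p : Fin h => (p : ℕ) < m).card : ℝ)
def cS (m : ℕ) (S : Finset (Fin h)) : ℝ := ((S.filter fun p : Fin h => ¬ (p : ℕ) < m).card : ℝ)

theorem cR_union (m : ℕ) {A B : Finset (Fin h)} (hAB : Disjoint A B) : cR m (A ∪ B) = cR m A + cR m B := by
  unfold cR
  rw [Finset.filter_union, Finset.card_union_of_disjoint (Finset.disjoint_filter_filter hAB)]
  push_cast; rfl

theorem cS_union (m : ℕ) {A B : Finset (Fin h)} (hAB : Disjoint A B) : cS m (A ∪ B) = cS m A + cS m B := by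
  unfold cS
  rw [Finset.filter_union, Finset.card_union_of_disjoint (Finset.disjoint_filter_filter hAB)]
  push_cast; rfl

theorem cR_add_cS (m : ℕ) (S : Finset (Fin h)) : cR m S + cS m S = S.card := by
  unfold cR cS
  exact_mod_cast Finset.card_filter_add_card_filter_not (fun p : Fin h => (p : ℕ) < m)

theorem cR_le (m : ℕ) (S : Finset (Fin h)) : cR m S ≤ m := by
  unfold cR
  have : (S.filter fun p : Fin h => (p : ℕ) < m).card ≤ (Finset.range m).card :=
    Finset.card_le_card_of_injOn (fun p : Fin h => (p : ℕ))
      (fun p hp => Finset.mem_range.mpr (Finset.mem_filter.mp hp).2)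
      (Fin.val_injective.injOn)
  rw [Finset.card_range] at this
  exact_mod_cast this

/-- `q_{W_R}(S) = −2|S∩R|² + 2|S∩R||S∖R| − (6m+1)|S∖R|`. -/
theorem qf_wR (m : ℕ) (S : Finset (Fin h)) :
    qf (wR h m) S = -2 * cR m S ^ 2 + 2 * cR m S * cS m S - (6 * (m : ℝ) + 1) * cS m S := by
  classical
  have inner₁ : ∀ x : Fin h, (x : ℕ) < m → ∑ y ∈ S, wR h m (x, y) = -2 * cR m S + cS m S := by
    intro x hx
    rw [← Finset.sum_filter_add_sum_filter_not S (fun p : Fin h => (p : ℕ) < m)]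
    have e1 : ∀ y ∈ S.filter (fun p : Fin h => (p : ℕ) < m), wR h m (x, y) = -2 := by
      intro y hy; rw [Finset.mem_filter] at hy; simp [wR, hx, hy.2]
    have e2 : ∀ y ∈ S.filter (fun p : Fin h => ¬ (p : ℕ) < m), wR h m (x, y) = 1 := by
      intro y hy; rw [Finset.mem_filter] at hy; simp [wR, hx, hy.2]
    rw [Finset.sum_congr rfl e1, Finset.sum_congr rfl e2, Finset.sum_const, Finset.sum_const]
    simp only [nsmul_eq_mul, cR, cS]; ring
  have inner₂ : ∀ x ∈ S, ¬ (x : ℕ) < m → ∑ y ∈ S, wR h m (x, y) = cR m S - (6 * (m : ℝ) + 1) := by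
    intro x hxS hx
    rw [← Finset.sum_filter_add_sum_filter_not S (fun p : Fin h => (p : ℕ) < m)]
    have e1 : ∀ y ∈ S.filter (fun p : Fin h => (p : ℕ) < m), wR h m (x, y) = 1 := by
      intro y hy; rw [Finset.mem_filter] at hy; simp [wR, hx, hy.2]
    have e2 : ∀ y ∈ S.filter (fun p : Fin h => ¬ (p : ℕ) < m), wR h m (x, y) = if x = y then -(6 * (m : ℝ) + 1) else 0 := by
      intro y hy; rw [Finset.mem_filter] at hy; simp [wR, hx, hy.2]
    have hx' : x ∈ S.filter (fun p : Fin h => ¬ (p : ℕ) < m) := Finset.mem_filter.mpr ⟨hxS, hx⟩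
    rw [Finset.sum_congr rfl e1, Finset.sum_congr rfl e2, Finset.sum_const, Finset.sum_ite_eq, if_pos hx']
    simp only [nsmul_eq_mul, cR]; ring
  unfold qf
  rw [← Finset.sum_filter_add_sum_filter_not S (fun p : Fin h => (p : ℕ) < m)]
  have o1 : ∀ x ∈ S.filter (fun p : Fin h => (p : ℕ) < m), ∑ y ∈ S, wR h m (x, y) = -2 * cR m S + cS m S :=
    fun x hx => inner₁ x (Finset.mem_filter.mp hx).2
  have o2 : ∀ x ∈ S.filter (fun p : Fin h => ¬ (p : ℕ) < m), ∑ y ∈ S, wR h m (x, y) = cR m S - (6 * (m : ℝ) + 1) :=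
    fun x hx => inner₂ x (Finset.mem_filter.mp hx).1 (Finset.mem_filter.mp hx).2
  rw [Finset.sum_congr rfl o1, Finset.sum_congr rfl o2, Finset.sum_const, Finset.sum_const]
  simp only [nsmul_eq_mul, cR, cS]; ring

/-- the sign lemma: with `|A| = |B|`, `⟨W_R, g_{A,B}⟩ ≤ −|A∖R| − 6|A∩R||B∩R|`. -/
theorem face_ineq_aux (M aR aS bR bS : ℝ) (haS : 0 ≤ aS) (hsz : aR + aS = bR + bS) (haR : aR ≤ M) (hbR : bR ≤ M) :
    (-2 * (aR + bR) ^ 2 + 2 * (aR + bR) * (aS + bS) - (6 * M + 1) * (aS + bS))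
      - (-2 * bR ^ 2 + 2 * bR * bS - (6 * M + 1) * bS) ≤ -aS - 6 * (aR * bR) := by
  have hbS : bS = aR + aS - bR := by linarith
  subst hbS
  nlinarith [mul_nonneg haS (sub_nonneg.2 haR), mul_nonneg haS (sub_nonneg.2 hbR)]

theorem sum_mul_chi_ind (w : Fin h → ℝ) (S : Finset (Fin h)) : ∑ p, w p * chi (ind S) p = ∑ p ∈ S, w p := by
  classical
  simp only [chi_ind, mul_ite, mul_one, mul_zero]
  rw [Finset.sum_ite_mem, Finset.univ_inter]

/-- a negative rank-one functional on a corona kernel: `−(Σ_{A∪B} w)² + (Σ_B w)²`. -/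
theorem negRankOne_dot_coronaKernel (w : Fin h → ℝ) (A B : Finset (Fin h)) :
    (fun x : Fin h × Fin h => -(w x.1 * w x.2)) ⬝ᵥ coronaKernel A B = -((∑ p ∈ A ∪ B, w p) ^ 2) + (∑ p ∈ B, w p) ^ 2 := by
  rw [coronaKernel, dotProduct_sub, negRankOne_dot_corVec, negRankOne_dot_corVec, sum_mul_chi_ind, sum_mul_chi_ind]
  ring

/-- the block embedding `R = {p < n+1} ⊂ [h]`. -/
def rhoR (n h : ℕ) (hm : n + 1 ≤ h) : Fin (n + 1) ↪ Fin h := Fin.castLEEmb hm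

@[simp] theorem rhoR_val (n h : ℕ) (hm : n + 1 ≤ h) (i : Fin (n + 1)) : ((rhoR n h hm i : Fin h) : ℕ) = i := rfl

/-- the partner block `{n+1 ≤ p < 2n+2}` (where the `B`'s of the selected zones live). -/
def rhoR' (n h : ℕ) (hh : 2 * n + 2 ≤ h) : Fin (n + 1) ↪ Fin h :=
  ⟨fun i => ⟨n + 1 + i, by omega⟩, fun i j hij => Fin.ext (by have := congrArg Fin.val hij; dsimp only at this; omega)⟩

@[simp] theorem rhoR'_val (n h : ℕ) (hh : 2 * n + 2 ≤ h) (i : Fin (n + 1)) : ((rhoR' n h hh i : Fin h) : ℕ) = n + 1 + i := rfl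

theorem uPush_rhoR_offblock (n h : ℕ) (hm : n + 1 ≤ h) (a : Finset (Fin n)) (p : Fin h) (hp : ¬ (p : ℕ) < n + 1) :
    uPush (rhoR n h hm) a p = 0 := by
  unfold uPush
  refine Finset.sum_eq_zero fun i _ => ?_
  rw [if_neg]
  intro hi
  apply hp
  rw [← hi, rhoR_val]
  exact i.isLt

theorem uPush_rhoR_at (n h : ℕ) (hm : n + 1 ≤ h) (a : Finset (Fin n)) (i : Fin (n + 1)) :
    uPush (rhoR n h hm) a (rhoR n h hm i) = uVec a i := by
  classical
  unfold uPush
  have : ∀ j : Fin (n + 1), (if rhoR n h hm j = rhoR n h hm i then uVec a j else 0) = if j = i then uVec a j else 0 := by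
    intro j; simp only [(rhoR n h hm).injective.eq_iff]
  rw [Finset.sum_congr rfl fun j _ => this j, Finset.sum_ite_eq']
  simp

theorem sumU_offblock (n h : ℕ) (hm : n + 1 ≤ h) (a : Finset (Fin n)) (S : Finset (Fin h))
    (hS : ∀ p ∈ S, ¬ (p : ℕ) < n + 1) : ∑ p ∈ S, uPush (rhoR n h hm) a p = 0 :=
  Finset.sum_eq_zero fun p hp => uPush_rhoR_offblock n h hm a p (hS p hp)

theorem offblock_of_cR_eq_zero (n : ℕ) (S : Finset (Fin h)) (h0 : cR (n + 1) S = 0) : ∀ p ∈ S, ¬ (p : ℕ) < n + 1 := by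
  unfold cR at h0
  have : (S.filter fun p : Fin h => (p : ℕ) < n + 1) = ∅ := Finset.card_eq_zero.mp (by exact_mod_cast h0)
  intro p hp hlt
  have hmem : p ∈ (S.filter fun p : Fin h => (p : ℕ) < n + 1) := Finset.mem_filter.mpr ⟨hp, hlt⟩
  rw [this] at hmem
  simp at hmem

theorem abs_uVec_le {n : ℕ} (a : Finset (Fin n)) (i : Fin (n + 1)) : |uVec a i| ≤ 1 := by
  unfold uVec
  refine Fin.cases ?_ (fun j => ?_) i
  · simp
  · simp only [Fin.cons_succ]; split_ifs <;> simp

theorem abs_uPush_le {n h : ℕ} (ρ : Fin (n + 1) ↪ Fin h) (a : Finset (Fin n)) (p : Fin h) : |uPush ρ a p| ≤ (n : ℝ) + 1 := by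
  unfold uPush
  refine (Finset.abs_sum_le_sum_abs _ _).trans ?_
  have : ∀ i ∈ (Finset.univ : Finset (Fin (n + 1))), |(if ρ i = p then uVec a i else 0)| ≤ (1 : ℝ) := by
    intro i _; split_ifs
    · exact abs_uVec_le a i
    · simp
  refine (Finset.sum_le_sum this).trans ?_
  simp

theorem abs_sumU_le {n h : ℕ} (ρ : Fin (n + 1) ↪ Fin h) (a : Finset (Fin n)) (S : Finset (Fin h)) :
    |∑ p ∈ S, uPush ρ a p| ≤ (h : ℝ) * ((n : ℝ) + 1) := by
  refine (Finset.abs_sum_le_sum_abs _ _).trans ?_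
  refine (Finset.sum_le_sum fun p _ => abs_uPush_le ρ a p).trans ?_
  rw [Finset.sum_const, nsmul_eq_mul]
  have hS : (S.card : ℝ) ≤ h := by exact_mod_cast (Finset.card_le_univ S).trans_eq (Fintype.card_fin h)
  have hn : (0 : ℝ) ≤ (n : ℝ) + 1 := by positivity
  exact mul_le_mul_of_nonneg_right hS hn

/-- the augmented functional `c_a = −(u_a^R)(u_a^R)ᵀ + λ·W_R` evaluated on a zone. -/
theorem zone_value (n h : ℕ) (hm : n + 1 ≤ h) (a : Finset (Fin n)) (lam : ℝ) (A B : Finset (Fin h)) (hAB : Disjoint A B) :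
    ((fun x : Fin h × Fin h => -(uPush (rhoR n h hm) a x.1 * uPush (rhoR n h hm) a x.2)) + lam • wR h (n + 1)) ⬝ᵥ
        coronaKernel A B
      = -((∑ p ∈ A, uPush (rhoR n h hm) a p) + ∑ p ∈ B, uPush (rhoR n h hm) a p) ^ 2
          + (∑ p ∈ B, uPush (rhoR n h hm) a p) ^ 2
          + lam * ((-2 * (cR (n + 1) A + cR (n + 1) B) ^ 2 + 2 * (cR (n + 1) A + cR (n + 1) B) * (cS (n + 1) A + cS (n + 1) B)
                      - (6 * ((n : ℝ) + 1) + 1) * (cS (n + 1) A + cS (n + 1) B))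
                    - (-2 * cR (n + 1) B ^ 2 + 2 * cR (n + 1) B * cS (n + 1) B - (6 * ((n : ℝ) + 1) + 1) * cS (n + 1) B)) := by
  rw [add_dotProduct, smul_dotProduct, smul_eq_mul, negRankOne_dot_coronaKernel, dot_coronaKernel, qf_wR, qf_wR,
    Finset.sum_union hAB, cR_union _ hAB, cS_union _ hAB]
  push_cast
  ring

/-- ★ every zone of `Z_cor` is priced nonpositively by `c_a` (`λ = (h(n+1))²`). -/
theorem zone_le (n h : ℕ) (hm : n + 1 ≤ h) (a : Finset (Fin n)) (A B : Finset (Fin h)) (hAB : Disjoint A B)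
    (hcard : A.card = B.card) :
    ((fun x : Fin h × Fin h => -(uPush (rhoR n h hm) a x.1 * uPush (rhoR n h hm) a x.2))
        + (((h : ℝ) * ((n : ℝ) + 1)) ^ 2) • wR h (n + 1)) ⬝ᵥ coronaKernel A B ≤ 0 := by
  classical
  rw [zone_value n h hm a _ A B hAB]
  have hsz : cR (n + 1) A + cS (n + 1) A = cR (n + 1) B + cS (n + 1) B := by
    rw [cR_add_cS, cR_add_cS]; exact_mod_cast hcard
  have haS : 0 ≤ cS (n + 1) A := Nat.cast_nonneg _
  have haR0 : 0 ≤ cR (n + 1) A := Nat.cast_nonneg _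
  have hbR0 : 0 ≤ cR (n + 1) B := Nat.cast_nonneg _
  have haR : cR (n + 1) A ≤ (n : ℝ) + 1 := by exact_mod_cast cR_le (n + 1) A
  have hbR : cR (n + 1) B ≤ (n : ℝ) + 1 := by exact_mod_cast cR_le (n + 1) B
  have hf := face_ineq_aux ((n : ℝ) + 1) (cR (n + 1) A) (cS (n + 1) A) (cR (n + 1) B) (cS (n + 1) B) haS hsz haR hbR
  set lam : ℝ := ((h : ℝ) * ((n : ℝ) + 1)) ^ 2 with hlam_def
  have hlam : 0 ≤ lam := sq_nonneg _
  set UA := ∑ p ∈ A, uPush (rhoR n h hm) a p with hUA_def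
  set UB := ∑ p ∈ B, uPush (rhoR n h hm) a p with hUB_def
  set f := (-2 * (cR (n + 1) A + cR (n + 1) B) ^ 2 + 2 * (cR (n + 1) A + cR (n + 1) B) * (cS (n + 1) A + cS (n + 1) B)
              - (6 * ((n : ℝ) + 1) + 1) * (cS (n + 1) A + cS (n + 1) B))
            - (-2 * cR (n + 1) B ^ 2 + 2 * cR (n + 1) B * cS (n + 1) B - (6 * ((n : ℝ) + 1) + 1) * cS (n + 1) B) with hf_def
  have hlf : lam * f ≤ lam * (-cS (n + 1) A - 6 * (cR (n + 1) A * cR (n + 1) B)) := mul_le_mul_of_nonneg_left hf hlam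
  have hlf0 : lam * f ≤ 0 :=
    hlf.trans (by nlinarith [mul_nonneg hlam haS, mul_nonneg hlam (mul_nonneg haR0 hbR0)])
  have hUBsq : UB ^ 2 ≤ lam := by
    have hb := abs_sumU_le (rhoR n h hm) a B
    rw [hlam_def, ← sq_abs UB]
    exact pow_le_pow_left₀ (abs_nonneg _) hb 2
  by_cases hb0 : cR (n + 1) B = 0
  · have hUB0 : UB = 0 := sumU_offblock n h hm a B (offblock_of_cR_eq_zero n B hb0)
    rw [hUB0]
    nlinarith [sq_nonneg UA]
  · by_cases ha0 : cR (n + 1) A = 0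
    · have hUA0 : UA = 0 := sumU_offblock n h hm a A (offblock_of_cR_eq_zero n A ha0)
      rw [hUA0]
      nlinarith
    · have ha1 : 1 ≤ cR (n + 1) A := by
        have : (A.filter fun p : Fin h => (p : ℕ) < n + 1).card ≠ 0 := by
          intro h0; apply ha0; unfold cR; exact_mod_cast h0
        unfold cR; exact_mod_cast Nat.one_le_iff_ne_zero.mpr this
      have hb1 : 1 ≤ cR (n + 1) B := by
        have : (B.filter fun p : Fin h => (p : ℕ) < n + 1).card ≠ 0 := by
          intro h0; apply hb0; unfold cR; exact_mod_cast h0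
        unfold cR; exact_mod_cast Nat.one_le_iff_ne_zero.mpr this
      have hab1 : 1 ≤ cR (n + 1) A * cR (n + 1) B := by nlinarith
      nlinarith [sq_nonneg (UA + UB), mul_nonneg hlam (sub_nonneg.2 hab1), mul_nonneg hlam haS]

/-- the rooted pattern set `{0} ∪ succ(b) ⊆ Fin (n+1)`. -/
def rootSet {n : ℕ} (b : Finset (Fin n)) : Finset (Fin (n + 1)) :=
  Finset.univ.filter fun i => (Fin.cons true (fun j => decide (j ∈ b)) : Fin (n + 1) → Bool) i = true

theorem zero_mem_rootSet {n : ℕ} (b : Finset (Fin n)) : (0 : Fin (n + 1)) ∈ rootSet b := by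
  simp [rootSet]

/-- the selected zone for the pattern `b`: `A_b = ρ(rootSet b) ⊆ R`, `B_b = ρ'(rootSet b) ⊆ Rᶜ` (same size). -/
theorem smAdm_selected (n h : ℕ) (hh : 2 * n + 3 ≤ h) (b : Finset (Fin n)) :
    SmAdm ((rootSet b).map (rhoR n h (by omega))) ((rootSet b).map (rhoR' n h (by omega))) := by
  classical
  refine ⟨?_, ?_, ?_, ?_⟩
  · rw [Finset.disjoint_left]
    intro p hpA hpB
    obtain ⟨i, -, rfl⟩ := Finset.mem_map.mp hpA
    obtain ⟨j, -, hj⟩ := Finset.mem_map.mp hpB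
    have := congrArg Fin.val hj
    simp only [rhoR'_val, rhoR_val] at this
    omega
  · rw [Finset.card_map, Finset.card_map]
  · rw [Finset.card_map]
    exact Finset.card_pos.mpr ⟨0, zero_mem_rootSet b⟩
  · intro hU
    have hlast : (⟨h - 1, by omega⟩ : Fin h) ∈ (rootSet b).map (rhoR n h (by omega)) ∪ (rootSet b).map (rhoR' n h (by omega)) := by
      rw [hU]; exact Finset.mem_univ _
    rcases Finset.mem_union.mp hlast with hA | hB
    · obtain ⟨i, -, hi⟩ := Finset.mem_map.mp hA
      have := congrArg Fin.val hi
      simp only [rhoR_val] at this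
      omega
    · obtain ⟨i, -, hi⟩ := Finset.mem_map.mp hB
      have := congrArg Fin.val hi
      simp only [rhoR'_val] at this
      omega

theorem selected_mem_zCorSM (n h : ℕ) (hh : 2 * n + 3 ≤ h) (b : Finset (Fin n)) :
    coronaKernel ((rootSet b).map (rhoR n h (by omega))) ((rootSet b).map (rhoR' n h (by omega))) ∈ zCorSM h := by
  classical
  set A := (rootSet b).map (rhoR n h (by omega))
  set B := (rootSet b).map (rhoR' n h (by omega))
  refine ⟨fun AB => if AB = (A, B) then 1 else 0, fun AB => by simp only; split_ifs <;> norm_num, fun AB hAB => ?_, ?_⟩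
  · simp only
    rw [if_neg]
    rintro rfl
    exact hAB (smAdm_selected n h hh b)
  · simp [ite_smul, Finset.sum_ite_eq']

/-- the slack of `c_a` at the selected zone `v_b`: `−(|a ∩ b| − 1)²` (the UDISJ pattern). -/
theorem slack_selected (n h : ℕ) (hh : 2 * n + 3 ≤ h) (a b : Finset (Fin n)) :
    ((fun x : Fin h × Fin h => -(uPush (rhoR n h (by omega)) a x.1 * uPush (rhoR n h (by omega)) a x.2))
        + (((h : ℝ) * ((n : ℝ) + 1)) ^ 2) • wR h (n + 1)) ⬝ᵥ
        coronaKernel ((rootSet b).map (rhoR n h (by omega))) ((rootSet b).map (rhoR' n h (by omega)))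
      = -((((a ∩ b).card : ℝ) - 1) ^ 2) := by
  classical
  have hm : n + 1 ≤ h := by omega
  have hh' : 2 * n + 2 ≤ h := by omega
  have hAB := (smAdm_selected n h hh b).1
  rw [zone_value n h hm a _ _ _ hAB]
  -- the `B`-block sum vanishes, the `A`-block sum is the BFPS pairing
  have hB0 : ∑ p ∈ (rootSet b).map (rhoR' n h hh'), uPush (rhoR n h hm) a p = 0 := by
    refine sumU_offblock n h hm a _ fun p hp => ?_
    obtain ⟨i, -, rfl⟩ := Finset.mem_map.mp hp
    simp only [rhoR'_val]; omega
  have hA : ∑ p ∈ (rootSet b).map (rhoR n h hm), uPush (rhoR n h hm) a p = ((a ∩ b).card : ℝ) - 1 := by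
    rw [Finset.sum_map]
    have : ∀ i ∈ rootSet b, uPush (rhoR n h hm) a ((rhoR n h hm) i) = uVec a i := fun i _ => uPush_rhoR_at n h hm a i
    rw [Finset.sum_congr rfl this, rootSet, Finset.sum_filter, ← sum_uVec_chi a b]
    refine Finset.sum_congr rfl fun i _ => ?_
    simp only [chi]
    split_ifs <;> simp
  -- block counts of the selected zone: `A ⊆ R`, `B ⊆ Rᶜ`, `|A| = |B|`
  have hcRA : cR (n + 1) ((rootSet b).map (rhoR n h hm)) = (rootSet b).card := by
    unfold cR
    rw [Finset.filter_true_of_mem, Finset.card_map]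
    intro p hp
    obtain ⟨i, -, rfl⟩ := Finset.mem_map.mp hp
    simp only [rhoR_val]; exact i.isLt
  have hcSA : cS (n + 1) ((rootSet b).map (rhoR n h hm)) = 0 := by
    unfold cS
    rw [Finset.filter_false_of_mem]
    · simp
    intro p hp
    obtain ⟨i, -, rfl⟩ := Finset.mem_map.mp hp
    simp only [rhoR_val, not_not]; exact i.isLt
  have hcRB : cR (n + 1) ((rootSet b).map (rhoR' n h hh')) = 0 := by
    unfold cR
    rw [Finset.filter_false_of_mem]
    · simp
    intro p hp
    obtain ⟨i, -, rfl⟩ := Finset.mem_map.mp hp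
    simp only [rhoR'_val]; omega
  have hcSB : cS (n + 1) ((rootSet b).map (rhoR' n h hh')) = (rootSet b).card := by
    unfold cS
    rw [Finset.filter_true_of_mem, Finset.card_map]
    intro p hp
    obtain ⟨i, -, rfl⟩ := Finset.mem_map.mp hp
    simp only [rhoR'_val]; omega
  rw [hB0, hA, hcRA, hcSA, hcRB, hcSB]
  ring

/-- ★★ (C4) PROVED: `xc(Z_cor(h)) ≥ 1.5^n − 1` whenever `2n + 3 ≤ h` — 41's canonical size-matched corona zonotope is NOT budgeted. -/
theorem zCorSMUnbudgeted_holds : ZCorSMUnbudgeted := by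
  classical
  intro n h r hh hEF
  refine hEF.three_pow_le
    (fun b => coronaKernel ((rootSet b).map (rhoR n h (by omega))) ((rootSet b).map (rhoR' n h (by omega))))
    (fun b => selected_mem_zCorSM n h hh b)
    (fun a => (fun x : Fin h × Fin h => -(uPush (rhoR n h (by omega)) a x.1 * uPush (rhoR n h (by omega)) a x.2))
        + (((h : ℝ) * ((n : ℝ) + 1)) ^ 2) • wR h (n + 1))
    (fun _ => 0) ?_ ?_ ?_
  · -- validity on the whole zonotope: every zone is priced nonpositively, coefficients are nonnegative
    rintro a x ⟨μ, hμ, hμ0, rfl⟩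
    rw [dotProduct_sum]
    refine Finset.sum_nonpos fun AB _ => ?_
    rw [dotProduct_smul, smul_eq_mul]
    by_cases hadm : SmAdm AB.1 AB.2
    · exact mul_nonpos_of_nonneg_of_nonpos (hμ AB).1 (zone_le n h (by omega) a AB.1 AB.2 hadm.1 hadm.2.1)
    · rw [hμ0 AB hadm, zero_mul]
  · intro a b hlt hcard
    rw [slack_selected n h hh a b, hcard] at hlt
    norm_num at hlt
  · intro a b hab
    rw [slack_selected n h hh a b, Finset.disjoint_iff_inter_eq_empty.mp hab]
    norm_num


/-! ### 14b. The certificate in general form: «BALANCED-FACE CLIQUE EXPOSURE».  Any corona zonotope `Σ_{(A,B) ∈ F} [0,1]·g_{A,B}` whose zone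
family `F` consists of disjoint size-matched pairs and CONTAINS the selected pairs `(ρ(S), ρ′(S))` (`S ∋ 0` a rooted subset of the block
`R = {p < n+1}`, `ρ′` the partner block) obeys `3^n ≤ (xc+1)·2^n`.  (`zCorSM` is the case `F = SmAdm`; thinning `Z_cor` does not help as long
as one block pair stays saturated.) -/

/-- a corona zonotope on an arbitrary zone family `F`. -/
def zCorFam (h : ℕ) (F : Finset (Fin h) → Finset (Fin h) → Prop) : Set (Fin h × Fin h → ℝ) :=
  {x | ∃ μ : Finset (Fin h) × Finset (Fin h) → ℝ, (∀ AB, 0 ≤ μ AB ∧ μ AB ≤ 1) ∧ (∀ AB, ¬ F AB.1 AB.2 → μ AB = 0) ∧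
    x = ∑ AB, μ AB • coronaKernel AB.1 AB.2}

/-- ★ BALANCED-FACE CLIQUE EXPOSURE (general certificate, PROVED). -/
theorem balancedFace_three_pow_le (n h r : ℕ) (hh : 2 * n + 3 ≤ h) (F : Finset (Fin h) → Finset (Fin h) → Prop)
    (hF : ∀ A B, F A B → Disjoint A B ∧ A.card = B.card)
    (hsel : ∀ b : Finset (Fin n), F ((rootSet b).map (rhoR n h (by omega))) ((rootSet b).map (rhoR' n h (by omega))))
    (hEF : HasEFOfSize (zCorFam h F) r) : 3 ^ n ≤ (r + 1) * 2 ^ n := by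
  classical
  refine hEF.three_pow_le
    (fun b => coronaKernel ((rootSet b).map (rhoR n h (by omega))) ((rootSet b).map (rhoR' n h (by omega))))
    (fun b => ?_)
    (fun a => (fun x : Fin h × Fin h => -(uPush (rhoR n h (by omega)) a x.1 * uPush (rhoR n h (by omega)) a x.2))
        + (((h : ℝ) * ((n : ℝ) + 1)) ^ 2) • wR h (n + 1))
    (fun _ => 0) ?_ ?_ ?_
  · -- the selected zones lie in the zonotope
    refine ⟨fun AB => if AB = ((rootSet b).map (rhoR n h (by omega)), (rootSet b).map (rhoR' n h (by omega))) then 1 else 0,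
      fun AB => by simp only; split_ifs <;> norm_num, fun AB hAB => ?_, ?_⟩
    · simp only
      rw [if_neg]
      rintro rfl
      exact hAB (hsel b)
    · simp [ite_smul, Finset.sum_ite_eq']
  · rintro a x ⟨μ, hμ, hμ0, rfl⟩
    rw [dotProduct_sum]
    refine Finset.sum_nonpos fun AB _ => ?_
    rw [dotProduct_smul, smul_eq_mul]
    by_cases hadm : F AB.1 AB.2
    · exact mul_nonpos_of_nonneg_of_nonpos (hμ AB).1 (zone_le n h (by omega) a AB.1 AB.2 (hF _ _ hadm).1 (hF _ _ hadm).2)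
    · rw [hμ0 AB hadm, zero_mul]
  · intro a b hlt hcard
    rw [slack_selected n h hh a b, hcard] at hlt
    norm_num at hlt
  · intro a b hab
    rw [slack_selected n h hh a b, Finset.disjoint_iff_inter_eq_empty.mp hab]
    norm_num

end Summit.ValiantsHypothesis.ValiantsHypothesis.Cruxes.NNDivisionHard.ConePricing44

end
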